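import Summits.Ventures.HSemireg.Pad4TowerLineDesignCert12
import Summits.Ventures.HSemireg.Pad4TowerLineDesignCert8
import Summits.Ventures.HSemireg.Pad4TowerSeedB1OddCeiling
import Summits.Ventures.HSemireg.Pad4TowerLineLetters

/-!
# DiamondUpFacts — the interior `X⁺` apex-hub fork, the floor-hub exclusion, hub forcing, the skew-pair law, (LVP3₈) ⇐ (LVN₈) ∧ (CD₈), and the floor-anchored step (LVP3_h) ⇒ (LVN_h)|floor (control g12)

STATUS LINE (mandatory): HC ∕ HC_CM ∕ HC_AV ∕ H2 = `stmt-HodgeConjecture-18881` (`BlochSeedDiscOne`) ∕ (T₈) ∕ (T₁₀) ∕ (CD) ∕ (LVN) ∕ (LVP3) are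
**NOT proved** here or anywhere in the tree; HC_CM is unused; letters∕designs ≠ sheaves ≠ a SEED; machine (census) ≠ kernel.  This file is
census-neutral KERNEL mathematics about H₁-static first-order designs in the diamond `◇_h` (vocabulary of `Summits/Ventures/HSemireg/Pad4Tower*`).

WHY THIS FILE (lens «control», req-36; director R19.459 (1)).  In `DiamondLevelLaws.lean` v2.1 (crux dir, §17–§21) the kernel chain
`ChargeDepthLaw 8 → LevelNLaw 8 → LevelP3Law 8 → OddLineFree 8 → SeedB1OddDiamondG1H1 8` takes the three UP-facts (CD), (LVN), (LVP3) as
HYPOTHESES: they are CENSUS facts (peel j318002 h8 `a459e02921a60310`, h10 `74004db439790926`; CHARGEDEPTH-d8-d12 `a045233a103d`), not theorems.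
Mining the ◇₈ peel (control g12, folder `alpha8/`, memo `DIAMOND-UP-FACTS-g12.md`) shows that their unit-propagation chains run TOP-DOWN in the
maximal causal top and that two first-layer mechanisms recur in every traced chain of the CD classes at `P`-cells with a floor letter and at the
`N`-cells `[cℓ_u | 2cI | 2cI | ·]`:

* **(K1) the INTERIOR `X⁺` APEX-HUB FORK** (`xplus_apexHub_fork`, §3): an `N`-hub `Ẑ ∈ C` with two apex letters `aI` (slots `g`, `f`) on an
  ARBITRARY line `a ≤ h` and a charged letter of causal top `a` at a third slot `j`, having two `P`-children below the apex at `g` in different null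
  directions, violates the `X⁺` sibling clause — PROVIDED the (H-e′)∕(H-b)∕`W_f` breakers are absent, and here they are DISCHARGED by the local form
  of (LVN) (`LevelNLocal C`: every `N`-cell of `C` with ≥ 2 charged letters is level): every potential breaker is an `N`-cell with a charged letter of
  top `> a` next to one of top `a` (§2 geometry).  The `N`-twins strictly between a child and the apex stay an explicit hypothesis (`hNT`), exactly as
  in the tree's ceiling version `DiamondLevelLaws.xplus_two_children_gen` (hub apex `hI`, breakers vacuous) which (K1) moves to the interior.
* **(K2) FLOOR LETTER + APEX ⇒ TWO CHILDREN** (`twoChildren_of_floor_apex`, §4): RULE D at an `N`-cell with a floor letter and an apex letter `aI`,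
  `a ≠ 0`, serves the apex slot below in two distinct null directions (the tree's floor engine `servedBelow_of_floorLetter`, apex case).
* **(K3) THE FLOOR-HUB EXCLUSION** (`no_floorHub`, §5): hence NO `N`-cell `[x | aI | aI | w]` with `x` a charged FLOOR letter of top `a` lies in an
  H₁-static ◇-design satisfying `LevelNLocal` and having no floor twins `[x | x′ | aI | w]`, `x′` charged of top `a` (§5; packaged h-uniformly in §6 as
  `LevelNLaw h → FloorTwinFree h → FloorHubFree h`, and — for a fourth letter `w` OFF the line `a`, where the twins are themselves (LVN)-cells —
  `LevelNLaw h → SkewFloorHubFree h`, a NON-law (‘-’ class) exclusion obtained from (LVN) alone).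

* **(K4) RULE D ABOVE A FLOOR `P`-CELL FORCES THE HUB** (`hub_of_floorP`, §7): a `P`-cell `[x | y | aI | w]` (`x` charged floor of top `a`, `y` a child
  of `aI`) forces — modulo (LVN)-cells, the `N`-twins `P(τ ↦ y′)` and the cover `[x⁺ | aI | …]` — its hub `P(τ ↦ aI) ∈ C`; with (K3): `no_floorP_apex`,
  `no_floorP_apex_charged` (the CD-`P`, n = 2 ∕ 3 floor classes with an apex letter).
* **(K5) THE SKEW-PAIR LAW** (`no_skewPairP`, `skewPairLawP_of_lvn`, §8): from RULE D + `LevelNLocal` ALONE, in every `P`-cell two charged letters of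
  different tops `t < t′` see every other letter at top `≥ t′` (a ‘-’-class exclusion no typed law names; no floor hypothesis).
* **(K7) A FLOOR LETTER NEXT TO AN OFF-LINE APEX** (`no_floor_offLine_apex`, §10): RULE D + (LVN) alone exclude `N`-cells `[x | aI | w | …]` with `x` charged
  floor, `a ∉ {0, top x}` and `top w < max(a, top x)` ((K2) child + (K5)); this discharges the cover hypothesis of (K4): `no_floorP_apex'`,
  `no_floorP_apex_charged'`, packaged h-uniformly as `FloorPApexFree h ⇐ (LVN_h) ∧ (FT_h)` (`floorPApexFree_of_laws`).
* **(K6) (LVP3_h) ⇐ (LVN_h) ∧ (CD_h) for h ≤ 8** (`levelP3_of_cd_lvn`, `levelP3Law_of_cd_lvn`, §9): below the line 8 the `P`-side partial level law is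
  a CONSEQUENCE of the local (LVN) and charge-depth inequalities under RULE D — so the (T₈) chain's census inputs reduce from {(CD₈), (LVN₈), (LVP3₈)}
  to {(CD₈), (LVN₈)} (the corollary must be restated in `DiamondLevelLaws`' namespace; definitions identical).  **(K6′)** (`levelP3Law_of_cd_lvn_res`,
  every h): the same argument is h-UNIFORM up to three explicit residual shapes `K6ResidualA∕B∕C` (empty for h ≤ 8: `k6ResidualFree_of_le_eight`), so
  (LVP3_h) ⇐ (CD_h) ∧ (LVN_h) ∧ (RES_h) with (RES_h) = “no residual-shape `P`-cell”; at h = 10, (RES₁₀) is a 41-orbit census fact (36 + 5 + 0 orbits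
  `P[6I+ℓ|y|y′|10I]`, `P[8I|8I+ℓ|8I+ℓ′|8I+ℓ″]`, all dead at peel rounds 22–24 of j318002 h10 `74004db439790926`) replacing the 205 770-orbit (LVP3₁₀) as
  input of the (T₁₀) chain `DiamondLevelLaws.dl3_of_partial_cd_le_ten`.
* **(K8) THE FLOOR-ANCHORED RULE-D STEP: (LVP3_h) [∧ (CD-P_h)] ⇒ (LVN_h) ON THE FLOOR-ANCHORED CELLS, every h** (`floorAnchor_lineChild`,
  `lvn_of_lvp3_floorAnchor`, `lvn_of_lvp3_floorApex`, `lvn_of_lvp3_allFloor`, `lvn_floorAnchored_residue_of_laws`, §11): RULE D at an `N`-cell with a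
  floor letter lowers any other charged letter ALONG ITS LINE (same causal top, smaller node) and any apex `aI ≠ O` to a charged letter of top `a`; the
  child is a `P`-cell with the same causal tops and the same (resp. one more) charged letters, so the (LVP3) instances make the parent LEVEL.  This is the
  converse direction of (K6) and the census's dominant mechanism: of the 46 586 (LVN) orbits of the ◇₈ peel, 38 986 (83.7 %) are one-step (K8) instances,
  7 186 have no floor letter, and the floor-anchored residue is exactly the 210 + 204 orbits `[x|x′|O|O]`, `[cℓ|c′ℓ′|c″ℓ″|O]` (control-g12 count).  So at
  every h, (LVN_h)|floor-anchored and (LVP3_h) are kernel-equivalent modulo (CD_h) and that residue; neither is proved.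

CENSUS ROWS THESE MIRROR (cite: peel j318002 h8 `a459e02921a60310`; control-g12 probe transcripts `alpha8/out_*.txt`): the CD-`N` (n = 1) hubs
`N[cℓ₋₁|2cI|2cI|2cI]` die at rounds 10 (P:Xp), 13, 13, 12 (B:DN) for c = 1…4, the CD-`P` (n = 2) floor cells `P[cℓ₋₁|(2c−2)I+ℓ₁|2cI|2cI]` at rounds
10, 12, 12, 11 (P:DN) through exactly `DP → hub`, `X⁺ → every sibling`, `DN at the hub` (K4 → K1 → K2), using as dead cells only (LVN) breakers
(e.g. 87 + 175 for c = 2), the CD-`N` floor twins of the same line (2 resp. 5) and one ‘-’ cover; the 378 `X⁺` escapes of the instance head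
`P[ℓ₋₁|ℓ_i|2I|2I]`, hub `N[2I|ℓ_i|2I|2I]`, `(s,u,w,f) = (0,0,2,2)` are ALL non-level 2-charged `N`-cells — the content of §3's discharge.  Nothing here
is a proof of (CD), (LVN) or (LVP3) in full: (K1)–(K5) are kernel EDGES of their unit-propagation DAG (`(LVN) ∧ (CD-N floor twins) ⇒ (CD-N, n = 1),
(CD-P, n = 2, 3 with an apex)`, `(LVP3) [∧ (CD-P)] ⇒ (LVN)|floor-anchored`), (K6) removes (LVP3₈) from the hypothesis list, and (LVN) — more
precisely its 7 186 + 414 orbits WITHOUT a (K8) step — emerges as the master census input at h = 8.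

This module imports only `Summits.Ventures.HSemireg.*` (crux modules do not import each other); §1 restates the `DiamondLevelLaws` vocabulary
VERBATIM (same bodies; a one-line bridge identifies them when the files are merged).
-/

set_option linter.dupNamespace false

namespace Summit.HodgeConjecture.HodgeConjecture.Cruxes.BlochSeedDiscOne.DiamondUpFacts

open Finset Summit.Ventures.HSemireg.Pad4Tower

/-! ## §1 Vocabulary (verbatim restatement of `DiamondLevelLaws` §1, §2, §17) -/

/-- NODE LEVEL `t(x) = α − |c|`. -/
def nodeLevel (x : BPoint) : ℤ := x.1 - absCharge x

/-- CAUSAL TOP `A(x) = α + |c|`. -/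
def causalTop (x : BPoint) : ℤ := x.1 + absCharge x

theorem onCeiling_iff (h : ℤ) (x : BPoint) : OnCeiling h x ↔ causalTop x = h := Iff.rfl

/-- a LEVEL cell: all four causal tops agree. -/
def LevelCell (Z : MCell) : Prop := ∀ f g, causalTop (Z f) = causalTop (Z g)

/-- the number of charged letters of a cell. -/
def chargeCount (Z : MCell) : ℕ := (Finset.univ.filter (fun f : Fin 4 => (Z f).2 ≠ (0, 0))).card

/-- the CHARGE-DEPTH inequalities of ONE configuration (verbatim `DiamondLevelLaws.CDIneq`). -/
def CDIneq (C : MConfig) : Prop :=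
  (∀ P ∈ C.upper, LevelCell P → ∀ f, (P f).2 ≠ (0, 0) → 2 * (chargeCount P : ℤ) - 2 ≤ nodeLevel (P f)) ∧
    (∀ Z ∈ C.lower, LevelCell Z → ∀ f, (Z f).2 ≠ (0, 0) → 2 * (chargeCount Z : ℤ) ≤ nodeLevel (Z f))

/-- **(CD_h)** (CONJECTURE ∕ census UP-fact; verbatim `DiamondLevelLaws.ChargeDepthLaw`). -/
def ChargeDepthLaw (h : ℤ) : Prop := ∀ C : MConfig, C.InDiamond h → C.G1Closed → C.StaticH1 → CDIneq C

/-- **(LVN) LOCAL FORM** on one configuration: every `N`-cell with at least two charged letters is level. -/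
def LevelNLocal (C : MConfig) : Prop := ∀ Z ∈ C.lower, 2 ≤ chargeCount Z → LevelCell Z

/-- **(LVN_h)** (CONJECTURE ∕ census UP-fact; verbatim `DiamondLevelLaws.LevelNLaw`, written with `LevelNLocal`). -/
def LevelNLaw (h : ℤ) : Prop := ∀ C : MConfig, C.InDiamond h → C.G1Closed → C.StaticH1 → LevelNLocal C

/-- **(LVP3_h)** (CONJECTURE ∕ census UP-fact; verbatim `DiamondLevelLaws.LevelP3Law`). -/
def LevelP3Law (h : ℤ) : Prop :=
  ∀ C : MConfig, C.InDiamond h → C.G1Closed → C.StaticH1 → ∀ P ∈ C.upper, 3 ≤ chargeCount P → LevelCell P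

theorem levelNLaw_iff (h : ℤ) :
    LevelNLaw h ↔ ∀ C : MConfig, C.InDiamond h → C.G1Closed → C.StaticH1 → ∀ Z ∈ C.lower, 2 ≤ chargeCount Z → LevelCell Z := Iff.rfl

/-! ## §2 Geometry of the breakers -/

theorem fin4_ne_add_two (k : Fin 4) : k ≠ k + 2 := by fin_cases k <;> decide

theorem fin4_add_two_add_two (r : Fin 4) : r + 2 + 2 = r := by fin_cases r <;> decide

theorem ray_zero (x : BPoint) (k : Fin 4) : ray x k 0 = x := by
  obtain ⟨a, b, c⟩ := x
  simp [ray]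

theorem bsub_dualPt0 (x y : BPoint) : bsub (dualPt 0 x) (dualPt 0 y) = bsub y x := by
  obtain ⟨a, b, c⟩ := x
  obtain ⟨a', b', c'⟩ := y
  simp only [bsub, Prod.mk.injEq]
  refine ⟨by ring, by ring, by ring⟩

/-- strictly-null-below is self-dual with the arguments swapped. -/
theorem nullBelow_dual0 (x y : BPoint) : NullBelow (dualPt 0 x) (dualPt 0 y) ↔ NullBelow y x := by
  obtain ⟨a, b, c⟩ := x
  obtain ⟨a', b', c'⟩ := y
  simp only [NullBelow]
  constructor
  · rintro ⟨h1, h2⟩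
    exact ⟨by omega, by linear_combination h2⟩
  · rintro ⟨h1, h2⟩
    exact ⟨by omega, by linear_combination h2⟩

/-- two distinct charged slots give `chargeCount ≥ 2`. -/
theorem two_le_chargeCount {Z : MCell} {σ τ : Fin 4} (hστ : σ ≠ τ) (hσ : (Z σ).2 ≠ (0, 0)) (hτ : (Z τ).2 ≠ (0, 0)) :
    2 ≤ chargeCount Z := by
  unfold chargeCount
  calc 2 = ({σ, τ} : Finset (Fin 4)).card := (Finset.card_pair hστ).symm
    _ ≤ _ := Finset.card_le_card (by
      intro f hf
      simp only [Finset.mem_insert, Finset.mem_singleton] at hf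
      rcases hf with rfl | rfl <;> simp [hσ, hτ])

theorem snd_ne_of_not_isApex {x : BPoint} (hx : ¬ isApex x) : x.2 ≠ (0, 0) := by
  intro h0; apply hx
  simp only [isApex]
  exact ⟨by rw [h0], by rw [h0]⟩

theorem not_isApex_of_snd_ne {x : BPoint} (hx : x.2 ≠ (0, 0)) : ¬ isApex x := by
  rintro ⟨h1, h2⟩; apply hx; exact Prod.ext h1 h2

/-- **the (LVN) contradiction**: an `N`-cell of a `LevelNLocal` configuration cannot carry two charged letters of different causal tops. -/
theorem lvn_contra {C : MConfig} (hLN : LevelNLocal C) {X : MCell} (hX : X ∈ C.lower) {m m' : Fin 4} (hmm : m ≠ m')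
    (hm : (X m).2 ≠ (0, 0)) (hm' : (X m').2 ≠ (0, 0)) (ht : causalTop (X m) ≠ causalTop (X m')) : False :=
  ht (hLN X hX (two_le_chargeCount hmm hm hm') m m')

/-- a charged μ₄ letter has `|c| ≥ 1`. -/
theorem one_le_absCharge {x : BPoint} (hax : x.2 = (0, 0) ∨ AxisPt x) (hne : x.2 ≠ (0, 0)) : 1 ≤ absCharge x := by
  rcases hax with h0 | ⟨h1, h2⟩ | ⟨h1, h2⟩
  · exact absurd h0 hne
  · simp only [absCharge, chargeOf, h2, sub_zero]; exact Int.one_le_abs h1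
  · simp only [absCharge, chargeOf, h1, zero_sub, abs_neg]; exact Int.one_le_abs h2

/-- a point strictly below an apex on a null ray is charged. -/
theorem not_isApex_below_apex {a : ℤ} {y : BPoint} {r : Fin 4} {e : ℤ} (he : 0 < e) (hy : ((a, 0, 0) : BPoint) = ray y r e) :
    ¬ isApex y := by
  obtain ⟨α, b, c⟩ := y
  simp only [ray, isApex, Prod.mk.injEq] at *
  fin_cases r <;> simp at hy ⊢ <;> omega

/-- a point of a null ray through an apex, other than the apex, is charged. -/
theorem not_isApex_between {a : ℤ} {y x : BPoint} {r : Fin 4} {e e₁ : ℤ} (h1 : ((a, 0, 0) : BPoint) = ray y r e₁) (hx : x = ray y r e)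
    (hne : e ≠ e₁) : ¬ isApex x := by
  obtain ⟨α, b, c⟩ := y
  subst hx
  simp only [ray, isApex, Prod.mk.injEq] at *
  fin_cases r <;> simp at h1 ⊢ <;> omega

/-- the part of a null ray below an apex `aI` lies on the line `a`. -/
theorem onCeiling_between {a : ℤ} {y x : BPoint} {r : Fin 4} {e e₁ : ℤ} (h1 : ((a, 0, 0) : BPoint) = ray y r e₁) (hx : x = ray y r e)
    (hle : e ≤ e₁) : OnCeiling a x := by
  obtain ⟨α, b, c⟩ := y
  subst hx
  simp only [ray, OnCeiling, absCharge, chargeOf, Prod.mk.injEq] at *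
  fin_cases r <;> simp at h1 ⊢ <;> (simp only [abs_eq_max_neg, max_def]; split_ifs <;> omega)

theorem fst_le_causalTop (x : BPoint) : x.1 ≤ causalTop x := by
  have := abs_nonneg (chargeOf x); unfold causalTop absCharge; omega

/-- letters of causal top `≤ a` lie causally below the apex `aI` (the tree's `effective_ceilingApex_sub` with `h := a`). -/
theorem effective_apex_sub {h a : ℤ} {y : BPoint} (hy : InDiamond h y) (ht : causalTop y ≤ a) : Effective (bsub (a, 0, 0) y) := by
  obtain ⟨α, b₁, b₂⟩ := y
  obtain ⟨hax, h1, _, _⟩ := hy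
  simp only [AxisPt, absCharge, chargeOf, Effective, causalTop] at *
  have key : ∀ z w : ℤ, |z| ≤ w → (0 - z) ^ 2 + (0 - 0) ^ 2 ≤ w ^ 2 ∧ (0 - 0) ^ 2 + (0 - z) ^ 2 ≤ w ^ 2 := fun z w hzw => by
    have h0 : 0 ≤ |z| := abs_nonneg z
    have e : (0 - z) ^ 2 = |z| ^ 2 := by rw [sq_abs z]; ring
    have hp : |z| ^ 2 ≤ w ^ 2 := pow_le_pow_left₀ h0 hzw 2
    constructor <;> nlinarith
  rcases hax with h0 | ⟨_, hb⟩ | ⟨ha, _⟩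
  · simp only [Prod.mk.injEq] at h0
    obtain ⟨rfl, rfl⟩ := h0
    simp only [sub_zero, abs_zero] at *
    exact ⟨by omega, by nlinarith⟩
  · subst hb
    simp only [sub_zero] at *
    exact ⟨by have := abs_nonneg b₁; omega, (key b₁ (a - α) (by omega)).1⟩
  · subst ha
    simp only [zero_sub, abs_neg] at *
    exact ⟨by have := abs_nonneg b₂; omega, (key b₂ (a - α) (by omega)).2⟩

/-- **a letter strictly null-ABOVE an apex `aI` is charged and has causal top `> a`** (the `W_f` ∕ (H-b) breaker letters). -/
theorem charged_of_nullAbove_apex {a : ℤ} {x : BPoint} (hax : x.2 = (0, 0) ∨ AxisPt x) (hn : NullBelow ((a, 0, 0) : BPoint) x) :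
    x.2 ≠ (0, 0) ∧ a < causalTop x := by
  obtain ⟨α, b, c⟩ := x
  obtain ⟨hlt, hsq⟩ := hn
  simp only [AxisPt, causalTop, absCharge, chargeOf, Prod.mk.injEq, sub_zero] at *
  rcases hax with ⟨hb, hc⟩ | ⟨hb, hc⟩ | ⟨hb, hc⟩
  · subst hb; subst hc
    exfalso
    have : (α - a) ^ 2 = 0 := by nlinarith
    have := pow_eq_zero_iff (n := 2) (by norm_num) |>.mp this
    omega
  · subst hc
    refine ⟨fun h => hb (by simp only [Prod.mk.injEq] at h; exact h.1), ?_⟩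
    have e : b ^ 2 = (α - a) ^ 2 := by nlinarith
    have hb' : |b| = |α - a| := (sq_eq_sq_iff_abs_eq_abs b (α - a)).mp e
    rw [abs_of_pos (by omega : (0 : ℤ) < α - a)] at hb'
    simp only [sub_zero]
    omega
  · subst hb
    refine ⟨fun h => hc (by simp only [Prod.mk.injEq] at h; exact h.2), ?_⟩
    have e : c ^ 2 = (α - a) ^ 2 := by nlinarith
    have hc' : |c| = |α - a| := (sq_eq_sq_iff_abs_eq_abs c (α - a)).mp e
    rw [abs_of_pos (by omega : (0 : ℤ) < α - a)] at hc'
    simp only [zero_sub, abs_neg]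
    omega

/-- **an apex strictly above the line `a` is timelike-separated from every child of `aI`** (the (H-e′) apex escape is no participant). -/
theorem timelike_child_apex {a : ℤ} {y x : BPoint} {r : Fin 4} {e : ℤ} (he : 0 < e) (hy : ((a, 0, 0) : BPoint) = ray y r e)
    (hap : isApex x) (hx : a < x.1) : Timelike (bsub y x) := by
  obtain ⟨α, b, c⟩ := y
  obtain ⟨x₁, x₂, x₃⟩ := x
  obtain ⟨h2, h3⟩ := hap
  simp only at h2 h3
  subst h2; subst h3
  simp only [ray, Timelike, Prod.mk.injEq] at *
  fin_cases r <;> simp at hy ⊢ <;> nlinarith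

/-! ## §3 (K1) THE INTERIOR `X⁺` APEX-HUB FORK -/

/-- **(K1) THE `X⁺` SIBLING CLAUSE AT AN INTERIOR APEX HUB** (KERNEL, every `h`, every line `a`).  An `N`-cell `Z ∈ C` (the HUB) with apex letters
`Z g = Z f = aI` and a CHARGED letter of causal top `a` at a third slot `j`, whose apex at `g` has two `P`-children `P₁ = Z(g ↦ y₁)` (direction `r₁`) and
`P₂ = Z(g ↦ y₂)` (direction `r₂ ≠ r₁`) in `C`, violates the clause `(P₁^∨; g, r₁; Z^∨; r₂, P₂^∨; f)` of the dual `X` family (`XPlusClosed`), provided no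
`N`-twin `Z(g ↦ x′)`, `x′` charged of top `a`, is present (`hNT`: it would be a lower `r₁`-server of `P₁` or a `w`-companion).  The participant-exact
breakers (H-e′), (H-b) and `W_f ≠ ∅` are DISCHARGED by `LevelNLocal C`: a breaker is an `N`-cell `X` agreeing with `P₁` off `{g}`, `{g,f}`, `{f}` or
`{f,g′}` whose new letter is either causally below `aI` (then (H-e′) holds), or an apex above the line (timelike from `y₁`: not a participant), or a
CHARGED letter of causal top `> a` (§2) sitting next to the charged top-`a` letter `y₁` or `Z j` — a non-level `N`-cell with two charged letters.
The tree's `DiamondLevelLaws.xplus_two_children_gen` is the case `a = h` (no room above the ceiling, breakers vacuous, no `j` needed). -/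
theorem xplus_apexHub_fork {h : ℤ} {C : MConfig} (hU : C.InDiamond h) (hX : XPlusClosed C) (hLN : LevelNLocal C)
    {Z : MCell} (hZ : Z ∈ C.lower) {a : ℤ} {g f j : Fin 4} (hfg : f ≠ g) (hjg : j ≠ g) (hjf : j ≠ f)
    (hg : Z g = (a, 0, 0)) (hf : Z f = (a, 0, 0)) (hjc : (Z j).2 ≠ (0, 0)) (hjt : causalTop (Z j) = a)
    {P₁ P₂ : MCell} (hP₁ : P₁ ∈ C.upper) (hP₂ : P₂ ∈ C.upper) {r₁ r₂ : Fin 4} (hr : r₂ ≠ r₁)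
    (h1 : UPartner Z P₁ g r₁) (h2 : UPartner Z P₂ g r₂)
    (hNT : ∀ X ∈ C.lower, MAgree X Z g → ¬ isApex (X g) → OnCeiling a (X g) → False) : False := by
  have hZg1 : (Z g).1 = a := by rw [hg]
  have hd₁ : 0 < a - (P₁ g).1 := by have := h1.2.1; omega
  have h1ray : ((a, 0, 0) : BPoint) = ray (P₁ g) r₁ (a - (P₁ g).1) := by have := h1.2.2; rw [hg] at this; exact this
  have hy_na : ¬ isApex (P₁ g) := not_isApex_below_apex hd₁ h1ray
  have hy_c : (P₁ g).2 ≠ (0, 0) := snd_ne_of_not_isApex hy_na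
  have hy_t : causalTop (P₁ g) = a := (onCeiling_iff a _).mp (onCeiling_between h1ray (ray_zero (P₁ g) r₁).symm hd₁.le)
  have hP₁f : P₁ f = (a, 0, 0) := (h1.1 f hfg).trans hf
  have hP₁j : P₁ j = Z j := h1.1 j hjg
  refine hX (dualCell 0 P₁) (dualCell_mem_dual_lower hP₁) (dualCell 0 Z) (dualCell_mem_dual_upper hZ) (dualCell 0 P₂)
    (dualCell_mem_dual_lower hP₂) g r₁ r₂ f ⟨?_, hfg, (uPartner_dual 0 Z P₁ g r₁).mpr h1, ?_, hr, ?_, ?_, ?_, ?_, ?_⟩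
  · -- `(P₁ g)^∨` is charged
    exact fun hap => hy_na ((isApex_dual 0 (P₁ g)).mp hap)
  · -- `Z^∨` is the topmost partner: an `N`-twin strictly between `P₁ g` and `aI` on the `r₁`-ray is absent (`hNT`)
    intro P hP hPu
    obtain ⟨X, hXl, rfl⟩ := Finset.mem_image.mp hP
    have hu : UPartner X P₁ g r₁ := (uPartner_dual 0 X P₁ g r₁).mp hPu
    show 0 - (X g).1 ≤ 0 - (Z g).1
    by_contra hlt
    have hXg : (X g).1 < a := by omega
    have hagZ : MAgree X Z g := fun m hm => (hu.1 m hm).symm.trans (h1.1 m hm)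
    exact hNT X hXl hagZ (not_isApex_between h1ray hu.2.2 (by omega)) (onCeiling_between h1ray hu.2.2 (by omega))
  · -- `P₂^∨` is an `r₂`-sibling of `Z^∨`
    exact ⟨magree_dual.mpr (fun m hm => (h2.1 m hm).symm), (ray_dual_iff 0 (Z g) (P₂ g) r₂).mpr ⟨h2.2.1, h2.2.2⟩⟩
  · -- no companion: an `N`-twin strictly between `P₂ g` and `aI` on the `r₂`-ray is absent (`hNT`)
    intro P hP hag hlt1 _ hray
    obtain ⟨X, hXl, rfl⟩ := Finset.mem_image.mp hP
    have hag' : MAgree Z X g := magree_dual.mp hag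
    obtain ⟨hlt, hZX⟩ := (ray_dual_iff 0 (Z g) (X g) r₂).mp ⟨hlt1, hray⟩
    rw [hg] at hZX
    have hagZ : MAgree X Z g := fun m hm => (hag' m hm).symm
    exact hNT X hXl hagZ (not_isApex_below_apex (by show (0 : ℤ) < a - (X g).1; omega) hZX)
      (onCeiling_between hZX (ray_zero (X g) r₂).symm (by show (0 : ℤ) ≤ a - (X g).1; omega))
  · -- (H-e′)⁺ DISCHARGED: the would-be breaker letter `X g` is below `aI`, or a timelike apex, or an (LVN) violation with `Z j`
    intro P hP hag hne hE hnT
    obtain ⟨X, hXl, rfl⟩ := Finset.mem_image.mp hP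
    show Effective (bsub (dualPt 0 (X g)) (dualPt 0 (Z g)))
    rw [bsub_dualPt0, hg]
    have hag' : MAgree X P₁ g := fun m hm => ((magree_dual.mp hag) m hm).symm
    have hnT' : ¬ Timelike (bsub (P₁ g) (X g)) := by
      change ¬ Timelike (bsub (dualPt 0 (X g)) (dualPt 0 (P₁ g))) at hnT; rwa [bsub_dualPt0] at hnT
    by_cases ht : causalTop (X g) ≤ a
    · exact effective_apex_sub (hU.1 X hXl g) ht
    · exfalso
      have ht' : a < causalTop (X g) := not_le.mp ht
      by_cases hap : isApex (X g)
      · have e : causalTop (X g) = (X g).1 := by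
          obtain ⟨h2, h3⟩ := hap
          simp only [causalTop, absCharge, chargeOf, h2, h3, sub_zero, abs_zero, add_zero]
        exact hnT' (timelike_child_apex hd₁ h1ray hap (by omega))
      · exact lvn_contra hLN hXl hjg.symm (snd_ne_of_not_isApex hap) (by rw [hag' j hjg, hP₁j]; exact hjc)
          (by rw [hag' j hjg, hP₁j, hjt]; exact ht'.ne')
  · -- (H-b)⁺ DISCHARGED: `X f` strictly null-above `aI` is charged of top `> a`, next to `X j = Z j`
    intro P hP hag2 hnb _
    obtain ⟨X, hXl, rfl⟩ := Finset.mem_image.mp hP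
    exfalso
    have hag' : MAgree2 P₁ X g f := magree2_dual.mp hag2
    have hnb' : NullBelow (P₁ f) (X f) := (nullBelow_dual0 (X f) (P₁ f)).mp hnb
    rw [hP₁f] at hnb'
    obtain ⟨hXf, hXft⟩ := charged_of_nullAbove_apex (hU.1 X hXl f).1 hnb'
    have hXj : X j = Z j := (hag' j hjg hjf).symm.trans hP₁j
    exact lvn_contra hLN hXl hjf.symm hXf (by rw [hXj]; exact hjc) (by rw [hXj, hjt]; exact hXft.ne')
  · -- `W_f⁺ = ∅` DISCHARGED: the same letter `X f`, next to `X g = y₁` or `X j = Z j`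
    intro P hP hnb
    obtain ⟨X, hXl, rfl⟩ := Finset.mem_image.mp hP
    have hnb' : NullBelow (P₁ f) (X f) := (nullBelow_dual0 (X f) (P₁ f)).mp hnb
    rw [hP₁f] at hnb'
    obtain ⟨hXf, hXft⟩ := charged_of_nullAbove_apex (hU.1 X hXl f).1 hnb'
    refine ⟨fun hag => ?_, fun g' hg'f hag2 _ => ?_⟩
    · have hag' : MAgree P₁ X f := magree_dual.mp hag
      have hXg : X g = P₁ g := (hag' g hfg.symm).symm
      exact lvn_contra hLN hXl hfg hXf (by rw [hXg]; exact hy_c) (by rw [hXg, hy_t]; exact hXft.ne')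
    · have hag' : MAgree2 P₁ X f g' := magree2_dual.mp hag2
      by_cases hgg : g' = g
      · have hXj : X j = Z j := (hag' j hjf (by rw [hgg]; exact hjg)).symm.trans hP₁j
        exact lvn_contra hLN hXl hjf.symm hXf (by rw [hXj]; exact hjc) (by rw [hXj, hjt]; exact hXft.ne')
      · have hXg : X g = P₁ g := (hag' g hfg.symm (Ne.symm hgg)).symm
        exact lvn_contra hLN hXl hfg hXf (by rw [hXg]; exact hy_c) (by rw [hXg, hy_t]; exact hXft.ne')

/-! ## §4 (K2) A FLOOR LETTER FORCES CHILDREN BELOW AN APEX IN TWO DIRECTIONS -/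

/-- every μ₄ letter has a NODE direction: an adapted coordinate of value `α − |c|` (verbatim `DiamondLevelLaws.exists_node_dir`). -/
theorem exists_node_dir {x : BPoint} (hxax : x.2 = (0, 0) ∨ AxisPt x) : ∃ m : Fin 4, Adapted x m ∧ coord x m = x.1 - absCharge x := by
  obtain ⟨α, a, b⟩ := x
  simp only [absCharge, chargeOf, AxisPt, Prod.mk.injEq] at hxax ⊢
  by_cases hb : b = 0
  · subst hb
    by_cases ha : 0 ≤ a
    · exact ⟨2, by simp [Adapted], by simp [coord, abs_of_nonneg ha]; omega⟩
    · exact ⟨0, by simp [Adapted], by simp [coord, abs_of_neg (not_le.1 ha)]⟩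
  · have ha : a = 0 := by omega
    subst ha
    by_cases hb' : 0 ≤ b
    · exact ⟨1, by simp [Adapted], by simp [coord, abs_of_nonneg hb']; omega⟩
    · exact ⟨3, by simp [Adapted], by simp [coord, abs_of_neg (not_le.1 hb')]⟩

/-- **no room below the floor off the top ray** (verbatim `DiamondLevelLaws.not_inDiamond_below_offtop`). -/
theorem not_inDiamond_below_offtop {x y : BPoint} {m r : Fin 4} {e : ℤ} (hx : OnFloor x) (hxax : x.2 = (0, 0) ∨ AxisPt x)
    (hm : Adapted x m) (hm0 : coord x m = 0) (hr : r ≠ m + 2) (he : 0 < e) (hxy : x = ray y r e)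
    (hyax : y.2 = (0, 0) ∨ AxisPt y) (hy : absCharge y ≤ y.1) : False := by
  obtain ⟨α, a, b⟩ := y
  subst hxy
  simp only [OnFloor, absCharge, chargeOf, coord, AxisPt, Adapted, Prod.mk.injEq] at *
  fin_cases m <;> fin_cases r <;> simp at hx hxax hm hm0 hr hyax hy <;>
    (simp only [abs_eq_max_neg, max_def] at *; split_ifs at * <;> omega)

theorem adapted_apex (a : ℤ) (k : Fin 4) : Adapted ((a, 0, 0) : BPoint) k := by fin_cases k <;> simp [Adapted]

theorem coord_apex (a : ℤ) (k : Fin 4) : coord ((a, 0, 0) : BPoint) k = a := by fin_cases k <;> simp [coord]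

/-- **(K2) RULE D at an `N`-cell with a FLOOR letter settles every frame coordinate of an apex letter `aI ≠ O` below** (KERNEL, every `h`; the apex case
of the tree's floor engine `DiamondLevelLaws.servedBelow_of_floorLetter`): the floor letter can be neither served nor covered below off its top ray
(`not_inDiamond_below_offtop`), so RULE D at the pair (node coordinate `0` of the floor letter, coordinate `a` of the apex) settles the apex side. -/
theorem settledBelow_apex_of_floorLetter {h : ℤ} {C : MConfig} (hU : C.InDiamond h) {Z : MCell} (hZ : Z ∈ C.lower) (hD : RuleDMu4N C Z)
    {i g : Fin 4} (hig : i ≠ g) (hi : OnFloor (Z i)) {a : ℤ} (hg : Z g = (a, 0, 0)) (ha : a ≠ 0) (k : Fin 4) :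
    SettledBelow C Z g k := by
  obtain ⟨m, hm, hm0⟩ := exists_node_dir (hU.1 Z hZ i).1
  have hm0' : coord (Z i) m = 0 := by rw [hm0, hi, sub_self]
  have hk : Adapted (Z g) k := by rw [hg]; exact adapted_apex a k
  have hne : coord (Z i) m ≠ coord (Z g) k := by rw [hm0', hg, coord_apex]; exact fun e => ha e.symm
  have below : ∀ P ∈ C.upper, ∀ r : Fin 4, r ≠ m + 2 → (P i).1 < (Z i).1 → Z i = ray (P i) r ((Z i).1 - (P i).1) → False :=
    fun P hP r hr hlt hray =>
      not_inDiamond_below_offtop hi (hU.1 Z hZ i).1 hm hm0' hr (by omega) hray (hU.2 P hP i).1 (hU.2 P hP i).2.1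
  rcases hD i g hig m k hm hk hne with ⟨r, hr, P, hP, hZP⟩ | hS | ⟨r, b, hr, _, P, hP, _, hi1, hi2, _, _⟩
  · exact (below P hP r hr hZP.2.1 hZP.2.2).elim
  · exact hS
  · have hr' : r ≠ m + 2 := by
      rcases hr with e | ⟨_, hne2⟩
      · rw [e]; exact fin4_ne_add_two m
      · exact hne2
    exact (below P hP r hr' hi1 hi2).elim

/-- **(K2′) hence the apex slot has `P`-children in two distinct null directions** (settle the coordinate `0`, then the coordinate antipodal to the
first child's direction). -/
theorem twoChildren_of_floor_apex {h : ℤ} {C : MConfig} (hU : C.InDiamond h) {Z : MCell} (hZ : Z ∈ C.lower) (hD : RuleDMu4N C Z)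
    {i g : Fin 4} (hig : i ≠ g) (hi : OnFloor (Z i)) {a : ℤ} (hg : Z g = (a, 0, 0)) (ha : a ≠ 0) :
    ∃ P₁ ∈ C.upper, ∃ P₂ ∈ C.upper, ∃ r₁ r₂ : Fin 4, r₂ ≠ r₁ ∧ UPartner Z P₁ g r₁ ∧ UPartner Z P₂ g r₂ := by
  obtain ⟨r₁, -, P₁, hP₁, h1⟩ := settledBelow_apex_of_floorLetter hU hZ hD hig hi hg ha 0
  obtain ⟨r₂, hr₂, P₂, hP₂, h2⟩ := settledBelow_apex_of_floorLetter hU hZ hD hig hi hg ha (r₁ + 2)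
  exact ⟨P₁, hP₁, P₂, hP₂, r₁, r₂, by rw [fin4_add_two_add_two] at hr₂; exact hr₂, h1, h2⟩

/-! ## §5 (K3) THE FLOOR-HUB EXCLUSION -/

/-- **(K3) NO FLOOR HUB** (KERNEL, every `h`, every line): in an `X⁺`-closed ◇-configuration satisfying `LevelNLocal`, an `N`-cell `Z` obeying RULE D with a
CHARGED FLOOR letter `x` at `i` (causal top `a = 2|c| ≥ 2`) and the apex `aI` at two further slots `g`, `f` is absent — unless one of its floor twins
`Z(g ↦ x′)`, `x′` charged of top `a`, is present (`hNT`).  Proof: (K2) gives the apex at `g` two children in different directions, (K1) with `j := i` fires.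
This is the common last step of the ◇₈ unit-propagation chains of the census classes CD-`N` (n = 1) `N[cℓ|2cI|2cI|2cI]` and CD-`P` (n = 2, floor)
`P[x|y|aI|aI]` (peel j318002 h8 `a459e02921a60310`; control g12 memo); the twins are the class CD-`N` (n ≥ 2, floor). -/
theorem no_floorHub {h : ℤ} {C : MConfig} (hU : C.InDiamond h) (hX : XPlusClosed C) (hLN : LevelNLocal C)
    {Z : MCell} (hZ : Z ∈ C.lower) (hD : RuleDMu4N C Z) {i g f : Fin 4} (hig : i ≠ g) (hif : i ≠ f) (hfg : f ≠ g)
    (hi : OnFloor (Z i)) (hic : (Z i).2 ≠ (0, 0)) {a : ℤ} (hit : causalTop (Z i) = a) (hg : Z g = (a, 0, 0)) (hf : Z f = (a, 0, 0))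
    (hNT : ∀ X ∈ C.lower, MAgree X Z g → ¬ isApex (X g) → OnCeiling a (X g) → False) : False := by
  have ha : a ≠ 0 := by
    have h1 := one_le_absCharge (hU.1 Z hZ i).1 hic
    have h2 : (Z i).1 = absCharge (Z i) := hi
    unfold causalTop at hit; omega
  obtain ⟨P₁, hP₁, P₂, hP₂, r₁, r₂, hr, h1, h2⟩ := twoChildren_of_floor_apex hU hZ hD hig hi hg ha
  exact xplus_apexHub_fork hU hX hLN hZ hfg hig hif hg hf hic hit hP₁ hP₂ hr h1 h2 hNT

/-- **(K3, local law form)**: with the LOCAL charge-depth inequalities `CDIneq C` in addition to `LevelNLocal C`, the twin hypothesis of `no_floorHub`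
discharges itself — a floor twin `Z(g ↦ x′)` is level (then (CD-`N`) fails at the floor letter: node level `0 < 2n`) or not (then (LVN) fails) — so NO floor
hub lies in `C` (the form in which `DiamondLevelLaws` §21–§22 consumes the census facts, cf. `child_not_node_four`). -/
theorem no_floorHub_of_cdIneq {h : ℤ} {C : MConfig} (hU : C.InDiamond h) (hX : XPlusClosed C) (hCD : CDIneq C) (hLN : LevelNLocal C)
    {Z : MCell} (hZ : Z ∈ C.lower) (hD : RuleDMu4N C Z) {i g f : Fin 4} (hig : i ≠ g) (hif : i ≠ f) (hfg : f ≠ g)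
    (hi : OnFloor (Z i)) (hic : (Z i).2 ≠ (0, 0)) {a : ℤ} (hit : causalTop (Z i) = a) (hg : Z g = (a, 0, 0)) (hf : Z f = (a, 0, 0)) :
    False := by
  refine no_floorHub hU hX hLN hZ hD hig hif hfg hi hic hit hg hf ?_
  intro X hX hag hna _
  have hXi : X i = Z i := hag i hig
  have h2 : 2 ≤ chargeCount X := two_le_chargeCount hig (by rw [hXi]; exact hic) (snd_ne_of_not_isApex hna)
  have hL : LevelCell X := hLN X hX h2
  have hcd := hCD.2 X hX hL i (by rw [hXi]; exact hic)
  have h0 : nodeLevel (X i) = 0 := by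
    have e : (Z i).1 = absCharge (Z i) := hi
    unfold nodeLevel; rw [hXi]; omega
  omega

/-! ## §6 h-uniform packaging: (LVN) ∧ (floor twins) ⇒ (floor hubs); the skew hub from (LVN) alone -/

/-- a FLOOR HUB at the slots `(i; g, f)`: a charged floor letter `x` at `i` and the apex `aI`, `a` = causal top of `x`, at `g` and at `f`. -/
def IsFloorHub (Z : MCell) (i g f : Fin 4) : Prop :=
  i ≠ g ∧ i ≠ f ∧ f ≠ g ∧ OnFloor (Z i) ∧ (Z i).2 ≠ (0, 0) ∧ Z g = (causalTop (Z i), 0, 0) ∧ Z f = (causalTop (Z i), 0, 0)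

/-- **(FH_h) FLOOR-HUB-FREE**: no `N`-cell of an H₁-static ◇_h-design is a floor hub (census class CD-`N`, n = 1 ∪ part of n ≥ 2 ∪ the skew ‘-’ hubs). -/
def FloorHubFree (h : ℤ) : Prop :=
  ∀ C : MConfig, C.InDiamond h → C.G1Closed → C.StaticH1 → ∀ Z ∈ C.lower, ∀ i g f : Fin 4, ¬ IsFloorHub Z i g f

/-- **(FT_h) FLOOR-TWIN-FREE**: no `N`-cell with a charged floor letter `x` at `i`, the apex `aI` (`a` = top of `x`) at `f` and a CHARGED letter of top
`a` at `g` (census class CD-`N`, n ≥ 2, with a floor letter — level ones violate (CD), non-level ones (LVN): `floorTwinFree_of_cd_lvn`). -/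
def FloorTwinFree (h : ℤ) : Prop :=
  ∀ C : MConfig, C.InDiamond h → C.G1Closed → C.StaticH1 → ∀ X ∈ C.lower, ∀ i g f : Fin 4, i ≠ g → i ≠ f → f ≠ g →
    OnFloor (X i) → (X i).2 ≠ (0, 0) → X f = (causalTop (X i), 0, 0) → ¬ isApex (X g) → causalTop (X g) = causalTop (X i) → False

/-- **(LVN_h) ∧ (FT_h) ⇒ (FH_h)** (KERNEL, every `h`): the kernel edge `(LVN) ∧ (CD-N, n ≥ 2, floor) ⇒ (CD-N, n = 1)` of the UP-fact DAG. -/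
theorem floorHubFree_of_laws {h : ℤ} (hLV : LevelNLaw h) (hTW : FloorTwinFree h) : FloorHubFree h := by
  intro C hU hG hS Z hZ i g f ⟨hig, hif, hfg, hi, hic, hg, hf⟩
  refine no_floorHub hU hS.2.1 (hLV C hU hG hS) hZ (hS.1.1 Z hZ) hig hif hfg hi hic rfl hg hf ?_
  intro X hX hag hna hc
  have hXi : X i = Z i := hag i hig
  have hXf : X f = Z f := hag f hfg
  exact hTW C hU hG hS X hX i g f hig hif hfg (by rw [hXi]; exact hi) (by rw [hXi]; exact hic) (by rw [hXf, hf, hXi]) hna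
    (by rw [hXi]; exact hc)

/-- (CD_h) ∧ (LVN_h) ⇒ (FT_h) (KERNEL; one line each way: a level twin has a charged floor letter of node level `0 < 2n`, a non-level one two charged letters). -/
theorem floorTwinFree_of_cd_lvn {h : ℤ} (hCD : ChargeDepthLaw h) (hLV : LevelNLaw h) : FloorTwinFree h := by
  intro C hU hG hS X hX i g f hig _ _ hi hic _ hna _
  have h2 : 2 ≤ chargeCount X := two_le_chargeCount hig hic (snd_ne_of_not_isApex hna)
  have hL : LevelCell X := hLV C hU hG hS X hX h2
  have hcd := (hCD C hU hG hS).2 X hX hL i hic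
  have h0 : nodeLevel (X i) = 0 := by
    have e : (X i).1 = absCharge (X i) := hi
    unfold nodeLevel; omega
  omega

/-- hence (CD_h) ∧ (LVN_h) ⇒ (FH_h) (KERNEL). -/
theorem floorHubFree_of_cd_lvn {h : ℤ} (hCD : ChargeDepthLaw h) (hLV : LevelNLaw h) : FloorHubFree h :=
  floorHubFree_of_laws hLV (floorTwinFree_of_cd_lvn hCD hLV)

/-- **THE SKEW FLOOR HUB IS EXCLUDED BY (LVN) ALONE** (KERNEL, every `h`): no `N`-cell `[x | aI | aI | w]` with `x` a charged floor letter of top `a` and a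
fourth letter `w` of causal top `≠ a` — a ‘-’-class (non-law) cell, e.g. `N[ℓ_u | 2I | 2I | 4I]` of ◇₈ — lies in an H₁-static ◇_h-design satisfying (LVN_h):
its floor twins `[x | x′ | aI | w]` carry the two charged letters `x`, `x′` and are non-level because of `w`. -/
theorem no_skewFloorHub {h : ℤ} (hLV : LevelNLaw h) {C : MConfig} (hU : C.InDiamond h) (hG : C.G1Closed) (hS : C.StaticH1)
    {Z : MCell} (hZ : Z ∈ C.lower) {i g f l : Fin 4} (hig : i ≠ g) (hif : i ≠ f) (hfg : f ≠ g) (hlg : l ≠ g)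
    (hi : OnFloor (Z i)) (hic : (Z i).2 ≠ (0, 0)) (hg : Z g = (causalTop (Z i), 0, 0)) (hf : Z f = (causalTop (Z i), 0, 0))
    (hl : causalTop (Z l) ≠ causalTop (Z i)) : False := by
  refine no_floorHub hU hS.2.1 (hLV C hU hG hS) hZ (hS.1.1 Z hZ) hig hif hfg hi hic rfl hg hf ?_
  intro X hX hag hna _
  have hXi : X i = Z i := hag i hig
  have hXl : X l = Z l := hag l hlg
  have h2 : 2 ≤ chargeCount X := two_le_chargeCount hig (by rw [hXi]; exact hic) (snd_ne_of_not_isApex hna)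
  have e := (hLV C hU hG hS) X hX h2 l i
  rw [hXi, hXl] at e
  exact hl e

/-! ## §7 (K4) RULE D ABOVE A FLOOR `P`-CELL FORCES THE HUB -/

/-- the (LVN) contradiction with separate witnesses: two charged slots, and two slots of different causal tops. -/
theorem lvn_contra' {C : MConfig} (hLN : LevelNLocal C) {X : MCell} (hX : X ∈ C.lower) {m m' : Fin 4} (hmm : m ≠ m')
    (hm : (X m).2 ≠ (0, 0)) (hm' : (X m').2 ≠ (0, 0)) {p p' : Fin 4} (ht : causalTop (X p) ≠ causalTop (X p')) : False :=
  ht (hLN X hX (two_le_chargeCount hmm hm hm') p p')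

theorem adapted_add_two (x : BPoint) (k : Fin 4) : Adapted x (k + 2) ↔ Adapted x k := by
  fin_cases k <;> simp [Adapted]

/-- antipodal frame coordinates sum to `2α`. -/
theorem coord_add_coord_add_two (x : BPoint) (m : Fin 4) : coord x m + coord x (m + 2) = 2 * x.1 := by
  obtain ⟨α, b, c⟩ := x
  fin_cases m <;> simp [coord] <;> ring

/-- the coordinate antipodal to the node coordinate is the causal top. -/
theorem coord_top_of_node {x : BPoint} {m : Fin 4} (hm0 : coord x m = x.1 - absCharge x) : coord x (m + 2) = causalTop x := by
  have := coord_add_coord_add_two x m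
  unfold causalTop; omega

/-- reading an apex ray from below: `aI = y + d·n_u` iff `y = aI − d·n_u`. -/
theorem eq_ray_neg {a : ℤ} {y : BPoint} {u : Fin 4} {d : ℤ} (hy : ((a, 0, 0) : BPoint) = ray y u d) :
    y = ray ((a, 0, 0) : BPoint) u (-d) := by
  obtain ⟨α, b, c⟩ := y
  fin_cases u <;> simp [ray, Prod.ext_iff] at hy ⊢ <;> omega

theorem adapted_ray_apex (a : ℤ) (m : Fin 4) (d : ℤ) :
    Adapted (ray ((a, 0, 0) : BPoint) m d) m ∧ Adapted (ray ((a, 0, 0) : BPoint) m d) (m + 2) := by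
  fin_cases m <;> simp [Adapted]

theorem ray_ray (x : BPoint) (k : Fin 4) (d e : ℤ) : ray (ray x k d) k e = ray x k (d + e) := by
  obtain ⟨α, b, c⟩ := x
  fin_cases k <;> simp <;> omega

/-- `e > 0` null steps up from an apex `aI` in direction `u`: a charged letter of causal top `a + 2e`. -/
theorem ray_apex_up {a e : ℤ} (he : 0 < e) (u : Fin 4) :
    causalTop (ray ((a, 0, 0) : BPoint) u e) = a + 2 * e ∧ (ray ((a, 0, 0) : BPoint) u e).2 ≠ (0, 0) := by
  fin_cases u <;> simp [causalTop, absCharge, chargeOf, abs_of_pos he, Prod.ext_iff] <;> omega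

/-- **raising a charged letter in its TOP direction** (`m` its node direction): `α ↦ α + e`, `|c| ↦ |c| + e` — the causal top grows by `2e`, the node
level and the floor property are kept (the encoder's move `R⁻¹`). -/
theorem ray_topdir {x : BPoint} (hxax : x.2 = (0, 0) ∨ AxisPt x) (hna : x.2 ≠ (0, 0)) {m : Fin 4} (hm : Adapted x m)
    (hm0 : coord x m = x.1 - absCharge x) {e : ℤ} (he : 0 < e) :
    (ray x (m + 2) e).1 = x.1 + e ∧ absCharge (ray x (m + 2) e) = absCharge x + e := by
  obtain ⟨α, b, c⟩ := x
  refine ⟨by fin_cases m <;> simp, ?_⟩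
  rcases hxax with h0 | ⟨hb, hc⟩ | ⟨hb, hc⟩
  · exact absurd h0 hna
  · simp only at hb hc; subst hc
    fin_cases m <;> simp [absCharge, chargeOf, coord, Adapted] at hm hm0 ⊢ <;>
      (simp only [abs_eq_max_neg, max_def] at *; split_ifs at * <;> omega)
  · simp only at hb hc; subst hb
    fin_cases m <;> simp [absCharge, chargeOf, coord, Adapted] at hm hm0 ⊢ <;>
      (simp only [abs_eq_max_neg, max_def] at *; split_ifs at * <;> omega)

/-- from a CHARGED μ₄ letter adapted to `{k, k+2}`, a null step UP of positive length to a μ₄ point runs in direction `k` or `k + 2`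
(verbatim `DiamondLevelLaws.ray_dir_of_adapted`). -/
theorem ray_dir_of_adapted {x y : BPoint} {k r : Fin 4} {e : ℤ} (hxax : x.2 = (0, 0) ∨ AxisPt x) (hna : ¬ isApex x) (hk : Adapted x k)
    (he : 0 < e) (hxy : y = ray x r e) (hyax : y.2 = (0, 0) ∨ AxisPt y) : r = k ∨ r = k + 2 := by
  obtain ⟨α, a, b⟩ := x
  subst hxy
  simp only [isApex, AxisPt, Adapted, Prod.mk.injEq] at *
  fin_cases k <;> fin_cases r <;> simp at hxax hna hk hyax ⊢ <;> omega

/-- **(K4) RULE D ABOVE A FLOOR `P`-CELL FORCES ITS HUB** (KERNEL, every `h`, every line).  A `P`-cell `P ∈ C` obeying RULE D with a charged FLOOR letter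
`x` at `i` (top `a`), a CHILD `y` of the apex `aI` at `τ` (`aI = y + d·n_u`, `d ≥ 1`) and the apex `aI` at a third slot `g`: RULE D at the pair
(top coordinate `a` of `x`, `u`-coordinate `a − 2d` of `y`) offers only (LVN)-cells — `x` raised in its top direction next to `y`, `y` continued beyond the
apex next to `x`, the (r2a) covers — EXCEPT: an `N`-twin `P(τ ↦ y′)`, `y′` charged of top `a` (`hNT`, census class CD-`N` with a floor letter), the
cover `P(i ↦ x⁺, τ ↦ aI)` with `x⁺` a floor letter above `x` (`hSub`: itself (LVN) when the fourth letter of `P` is charged of top `a`, a ‘-’-class cell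
`[x⁺ | aI | aI | aI]` when it is the apex), and the HUB `P(τ ↦ aI)`.  So the hub is present. -/
theorem hub_of_floorP {h : ℤ} {C : MConfig} (hU : C.InDiamond h) (hLN : LevelNLocal C) {P : MCell} (hP : P ∈ C.upper) (hDP : RuleDMu4P C P)
    {i τ g : Fin 4} (hiτ : i ≠ τ) (hig : i ≠ g) (hτg : τ ≠ g) {a : ℤ} (hi : OnFloor (P i)) (hic : (P i).2 ≠ (0, 0)) (hit : causalTop (P i) = a)
    {u : Fin 4} {d : ℤ} (hd : 0 < d) (hy : ((a, 0, 0) : BPoint) = ray (P τ) u d) (hg : P g = (a, 0, 0))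
    (hNT : ∀ N ∈ C.lower, MAgree N P τ → ¬ isApex (N τ) → OnCeiling a (N τ) → False)
    (hSub : ∀ N ∈ C.lower, MAgree2 N P i τ → N τ = (a, 0, 0) → OnFloor (N i) → (P i).1 < (N i).1 → False) :
    ∃ N ∈ C.lower, MAgree N P τ ∧ N τ = (a, 0, 0) := by
  have hxax := (hU.2 P hP i).1
  have hxna : ¬ isApex (P i) := not_isApex_of_snd_ne hic
  obtain ⟨m, hm, hm0⟩ := exists_node_dir hxax
  have hk : Adapted (P i) (m + 2) := (adapted_add_two _ _).mpr hm
  have hkc : coord (P i) (m + 2) = a := by rw [coord_top_of_node hm0, hit]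
  have hyeq : P τ = ray ((a, 0, 0) : BPoint) u (-d) := eq_ray_neg hy
  have hyad : Adapted (P τ) u := by rw [hyeq]; exact (adapted_ray_apex a u (-d)).1
  have hyc : coord (P τ) u = a - 2 * d := by rw [hyeq, coord_ray_self, coord_apex]; ring
  have hy_na : ¬ isApex (P τ) := not_isApex_below_apex hd hy
  have hy_ch : (P τ).2 ≠ (0, 0) := snd_ne_of_not_isApex hy_na
  have hy_t : causalTop (P τ) = a := (onCeiling_iff a _).mp (onCeiling_between hy (ray_zero (P τ) u).symm hd.le)
  have hne : coord (P i) (m + 2) ≠ coord (P τ) u := by rw [hkc, hyc]; omega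
  -- a letter of `N ∈ E₋` served above `x` off the node direction is `x` raised in its top direction: charged, top `a + 2e`, still floor
  have raised : ∀ N ∈ C.lower, ∀ r : Fin 4, r ≠ m → (P i).1 < (N i).1 → N i = ray (P i) r ((N i).1 - (P i).1) →
      (N i).2 ≠ (0, 0) ∧ causalTop (N i) = a + 2 * ((N i).1 - (P i).1) ∧ OnFloor (N i) := by
    intro N hN r hr hlt hray
    have he : 0 < (N i).1 - (P i).1 := by omega
    rcases ray_dir_of_adapted hxax hxna hm he hray (hU.1 N hN i).1 with rfl | rfl
    · exact (hr rfl).elim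
    · obtain ⟨h1, h2⟩ := ray_topdir hxax hic hm hm0 he
      rw [← hray] at h1 h2
      have hc1 := one_le_absCharge hxax hic
      have hfl : (P i).1 = absCharge (P i) := hi
      refine ⟨fun h0 => ?_, ?_, ?_⟩
      · have : absCharge (N i) = 0 := by simp [absCharge, chargeOf, h0]
        omega
      · unfold causalTop at hit ⊢; omega
      · show (N i).1 = absCharge (N i); omega
  -- a letter served above `y` in direction `u`: a twin, the apex, or a charged letter beyond the apex
  have beyond : ∀ N ∈ C.lower, (P τ).1 < (N τ).1 → N τ = ray (P τ) u ((N τ).1 - (P τ).1) → d < (N τ).1 - (P τ).1 →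
      (N τ).2 ≠ (0, 0) ∧ a < causalTop (N τ) := by
    intro N hN hlt hray hgt
    have e2 : N τ = ray ((a, 0, 0) : BPoint) u ((N τ).1 - (P τ).1 - d) := by
      rw [hray, hy, ray_ray]; congr 1; ring
    obtain ⟨ht, hc⟩ := ray_apex_up (a := a) (by omega : (0 : ℤ) < (N τ).1 - (P τ).1 - d) u
    rw [← e2] at ht hc
    exact ⟨hc, by omega⟩
  rcases hDP i τ hiτ (m + 2) u hk hyad hne with ⟨r, hr, N, hN, hNP⟩ | ⟨r, hr, N, hN, hNP⟩ | ⟨a', b, ha', hb, N, hN, hag2, hi1, hi2, hτ1, hτ2⟩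
  · -- `x` served above: `N = P(i ↦ x⁺)` is a non-level (LVN) cell (`x⁺` top `> a`, `y` top `a`)
    exfalso
    have hr' : r ≠ m := by rw [fin4_add_two_add_two] at hr; exact hr
    obtain ⟨hc, ht, -⟩ := raised N hN r hr' hNP.2.1 hNP.2.2
    have hNτ : N τ = P τ := (hNP.1 τ hiτ.symm).symm
    exact lvn_contra hLN hN hiτ hc (by rw [hNτ]; exact hy_ch) (by rw [hNτ, hy_t, ht]; have := hNP.2.1; omega)
  · -- `y` served above in direction `r ≠ u + 2`, i.e. `r = u`: twin ∕ HUB ∕ beyond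
    rcases ray_dir_of_adapted (hU.2 P hP τ).1 hy_na hyad (by have := hNP.2.1; omega) hNP.2.2 (hU.1 N hN τ).1 with rfl | rfl
    · have hagN : MAgree N P τ := fun j hj => (hNP.1 j hj).symm
      rcases lt_trichotomy ((N τ).1 - (P τ).1) d with hlt | heq | hgt
      · exact (hNT N hN hagN (not_isApex_between hy hNP.2.2 (ne_of_lt hlt)) (onCeiling_between hy hNP.2.2 hlt.le)).elim
      · exact ⟨N, hN, hagN, by rw [hNP.2.2, heq]; exact hy.symm⟩
      · exfalso
        obtain ⟨hc, ht⟩ := beyond N hN hNP.2.1 hNP.2.2 hgt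
        have hNi : N i = P i := (hNP.1 i hiτ).symm
        exact lvn_contra hLN hN hiτ.symm hc (by rw [hNi]; exact hic) (by rw [hNi, hit]; exact ht.ne')
    · exact (hr rfl).elim
  · -- the (r2a) cover: `N = P(i ↦ x⁺, τ ↦ y⁺)`
    exfalso
    have ha'' : a' = m + 2 := by
      rcases ha' with e | ⟨hap, _⟩
      · exact e
      · exact (hxna hap).elim
    have hb' : b = u := by
      rcases hb with e | ⟨hap, _⟩
      · exact e
      · exact (hy_na hap).elim
    subst ha''; subst hb'
    obtain ⟨hci, hti, hfli⟩ := raised N hN (m + 2) (fin4_ne_add_two m).symm hi1 hi2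
    rcases lt_trichotomy ((N τ).1 - (P τ).1) d with hlt | heq | hgt
    · -- `y⁺` strictly between: charged of top `a`, next to `x⁺` of top `> a`
      have hτt : causalTop (N τ) = a := (onCeiling_iff a _).mp (onCeiling_between hy hτ2 hlt.le)
      exact lvn_contra hLN hN hiτ hci (snd_ne_of_not_isApex (not_isApex_between hy hτ2 (ne_of_lt hlt))) (by rw [hti, hτt]; omega)
    · -- `y⁺ = aI`: the excluded cover `[x⁺ | aI | …]`
      exact hSub N hN hag2 (by rw [hτ2, heq]; exact hy.symm) hfli hi1
    · -- `y⁺` beyond the apex: non-level through the apex at `g`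
      obtain ⟨hcτ, _⟩ := beyond N hN hτ1 hτ2 hgt
      have hNg : N g = (a, 0, 0) := (hag2 g hig.symm hτg.symm).trans hg
      have hgt' : causalTop (N g) = a := by rw [hNg]; simp [causalTop, absCharge, chargeOf]
      exact lvn_contra' hLN hN hiτ hci hcτ (p := i) (p' := g) (by rw [hti, hgt']; omega)

/-- **(K3 ∧ K4) NO FLOOR `P`-CELL NEXT TO A CHILD AND ITS APEX** (KERNEL, every `h`, every line): in an `X⁺`-closed, RULE-D-closed ◇-configuration with
`LevelNLocal`, no `P`-cell `[x | y | aI | w]` — `x` a charged floor letter of top `a` at `i`, `y` a child of `aI` at `τ`, the apex `aI` at `g`, ANY fourth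
letter `w` — is present, given the absence of the floor twins on both levels (`hNTP`: `N`-cells `P(τ ↦ y′)`, `y′` charged of top `a`; `hNTZ`: `N`-cells
`Ẑ(g ↦ x′)` of the hub `Ẑ = P(τ ↦ aI)`; both census class CD-`N` with a floor letter) and of the cover `P(i ↦ x⁺, τ ↦ aI)` (`hSub`; discharged by (LVN)
when `w` is charged of top `a`: `no_floorP_apex_charged`).  Proof: `hub_of_floorP` puts the hub in `C`, `no_floorHub` (X⁺ at `g`, free apex `τ`) kills it.
This is the ◇₈ census chain of the CD-`P` (n = 2, floor) orbits `P[cℓ | (2c−2)I+ℓ′ | 2cI | 2cI]` VERBATIM (peel j318002 h8 a459e02921a60310: rounds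
10, 12, 12, 11 and kind P:DN for c = 1, 2, 3, 4; control-g12 probe transcript: `DP → hub true`, `X⁺ → every sibling false`, `DN at the hub → conflict`,
dead cells used = (LVN) breakers + the CD-`N` twins + one ‘-’ cover). -/
theorem no_floorP_apex {h : ℤ} {C : MConfig} (hU : C.InDiamond h) (hX : XPlusClosed C) (hD : RuleDMu4Closed C) (hLN : LevelNLocal C)
    {P : MCell} (hP : P ∈ C.upper) {i τ g : Fin 4} (hiτ : i ≠ τ) (hig : i ≠ g) (hτg : τ ≠ g)
    {a : ℤ} (hi : OnFloor (P i)) (hic : (P i).2 ≠ (0, 0)) (hit : causalTop (P i) = a)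
    {u : Fin 4} {d : ℤ} (hd : 0 < d) (hy : ((a, 0, 0) : BPoint) = ray (P τ) u d) (hg : P g = (a, 0, 0))
    (hNTP : ∀ N ∈ C.lower, MAgree N P τ → ¬ isApex (N τ) → OnCeiling a (N τ) → False)
    (hNTZ : ∀ N ∈ C.lower, MAgree2 N P g τ → N τ = (a, 0, 0) → ¬ isApex (N g) → OnCeiling a (N g) → False)
    (hSub : ∀ N ∈ C.lower, MAgree2 N P i τ → N τ = (a, 0, 0) → OnFloor (N i) → (P i).1 < (N i).1 → False) : False := by
  obtain ⟨Z, hZ, hag, hZτ⟩ := hub_of_floorP hU hLN hP (hD.2 P hP) hiτ hig hτg hi hic hit hd hy hg hNTP hSub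
  have hZi : Z i = P i := hag i hiτ
  refine no_floorHub hU hX hLN hZ (hD.1 Z hZ) hig hiτ hτg (by rw [hZi]; exact hi) (by rw [hZi]; exact hic) (by rw [hZi]; exact hit)
    ((hag g hτg.symm).trans hg) hZτ ?_
  intro X hX' hagX hna hceil
  refine hNTZ X hX' (fun j hjg hjτ => (hagX j hjg).trans (hag j hjτ)) ((hagX τ hτg).trans hZτ) hna hceil

/-- … and with the fourth letter `w = P f` CHARGED of top `a` (the level CD-`P` cell with n = 3 and a floor letter) the cover hypothesis discharges itself
by (LVN): the cover `P(i ↦ x⁺, τ ↦ aI)` holds `x⁺` (top `> a`) next to `w` (top `a`). -/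
theorem no_floorP_apex_charged {h : ℤ} {C : MConfig} (hU : C.InDiamond h) (hX : XPlusClosed C) (hD : RuleDMu4Closed C) (hLN : LevelNLocal C)
    {P : MCell} (hP : P ∈ C.upper) {i τ g f : Fin 4} (hiτ : i ≠ τ) (hig : i ≠ g) (hτg : τ ≠ g) (hfi : f ≠ i) (hfτ : f ≠ τ)
    {a : ℤ} (hi : OnFloor (P i)) (hic : (P i).2 ≠ (0, 0)) (hit : causalTop (P i) = a)
    {u : Fin 4} {d : ℤ} (hd : 0 < d) (hy : ((a, 0, 0) : BPoint) = ray (P τ) u d) (hg : P g = (a, 0, 0))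
    (hfc : (P f).2 ≠ (0, 0)) (hft : causalTop (P f) = a)
    (hNTP : ∀ N ∈ C.lower, MAgree N P τ → ¬ isApex (N τ) → OnCeiling a (N τ) → False)
    (hNTZ : ∀ N ∈ C.lower, MAgree2 N P g τ → N τ = (a, 0, 0) → ¬ isApex (N g) → OnCeiling a (N g) → False) : False := by
  refine no_floorP_apex hU hX hD hLN hP hiτ hig hτg hi hic hit hd hy hg hNTP hNTZ ?_
  intro N hN hag2 _ hfl hlt
  have hNf : N f = P f := hag2 f hfi hfτ
  have hxfl : (P i).1 = absCharge (P i) := hi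
  have hNfl : (N i).1 = absCharge (N i) := hfl
  have hc1 := one_le_absCharge (hU.2 P hP i).1 hic
  have hNc : (N i).2 ≠ (0, 0) := fun h0 => by
    have : absCharge (N i) = 0 := by simp [absCharge, chargeOf, h0]
    omega
  exact lvn_contra hLN hN hfi.symm hNc (by rw [hNf]; exact hfc) (by rw [hNf, hft]; unfold causalTop at hit ⊢; omega)

/-! ## §8 (K5) THE SKEW-PAIR LAW FOR `P`-CELLS — a ‘-’-class exclusion from (LVN) + RULE D -/

/-- a letter of `N ∈ E₋` served strictly ABOVE the charged letter `x = P i` off its node direction `m` is `x` raised in its top direction: charged, causal top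
`+ 2e`, the same node level, and floor if `x` was floor. -/
theorem served_topdir {h : ℤ} {C : MConfig} (hU : C.InDiamond h) {P : MCell} (hP : P ∈ C.upper) {i : Fin 4} (hic : (P i).2 ≠ (0, 0))
    {m : Fin 4} (hm : Adapted (P i) m) (hm0 : coord (P i) m = (P i).1 - absCharge (P i)) {N : MCell} (hN : N ∈ C.lower) {r : Fin 4} (hr : r ≠ m)
    (hlt : (P i).1 < (N i).1) (hray : N i = ray (P i) r ((N i).1 - (P i).1)) :
    (N i).2 ≠ (0, 0) ∧ causalTop (N i) = causalTop (P i) + 2 * ((N i).1 - (P i).1) ∧ (OnFloor (P i) → OnFloor (N i)) ∧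
      nodeLevel (N i) = nodeLevel (P i) := by
  have hxax := (hU.2 P hP i).1
  have he : 0 < (N i).1 - (P i).1 := by omega
  rcases ray_dir_of_adapted hxax (not_isApex_of_snd_ne hic) hm he hray (hU.1 N hN i).1 with rfl | rfl
  · exact (hr rfl).elim
  · obtain ⟨h1, h2⟩ := ray_topdir hxax hic hm hm0 he
    rw [← hray] at h1 h2
    have hc1 := one_le_absCharge hxax hic
    refine ⟨fun h0 => ?_, ?_, fun hfl => ?_, ?_⟩
    · have : absCharge (N i) = 0 := by simp [absCharge, chargeOf, h0]
      omega
    · unfold causalTop; omega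
    · have : (P i).1 = absCharge (P i) := hfl
      show (N i).1 = absCharge (N i); omega
    · unfold nodeLevel; omega

/-- **(K5) THE SKEW-PAIR LAW FOR `P`-CELLS** (KERNEL, every `h`): a `P`-cell with two CHARGED letters `x = P i`, `x′ = P i′` of causal tops `t < t′` and a
letter `P l` (`l ∉ {i, i′}`) of top `< t′` contradicts RULE D + `LevelNLocal`: RULE D at the pair of top coordinates (`t ≠ t′`; a charged letter's upward null
neighbours off its node direction are its raises in the top direction, `served_topdir`) can only be met by raising `x` or `x′` or both in the top direction,
and each resulting `N`-cell holds two charged letters and two letters of different tops.  No floor hypothesis is needed.  (It names a ‘-’-class family of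
the ◇₈ census that no typed law covers — e.g. `P[2ℓ₁|ℓ₋₁|2I|2I]`, the children of the skew floor cells `[2ℓ|2I|2I|2I]` — and is consistent with the ten
(LVP₂)-violating survivors `P[6I+ℓ₋₁|6I+2ℓ|10I|10I]` of ◇₁₀ (j318002 h10 74004db439790926), whose other letters sit AT the higher top `10`.) -/
theorem no_skewPairP {h : ℤ} {C : MConfig} (hU : C.InDiamond h) (hLN : LevelNLocal C) {P : MCell} (hP : P ∈ C.upper) (hDP : RuleDMu4P C P)
    {i i' l : Fin 4} (hii' : i ≠ i') (hli : l ≠ i) (hli' : l ≠ i') (hic : (P i).2 ≠ (0, 0)) (hi'c : (P i').2 ≠ (0, 0))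
    (htt : causalTop (P i) < causalTop (P i')) (hl : causalTop (P l) < causalTop (P i')) : False := by
  obtain ⟨m, hm, hm0⟩ := exists_node_dir (hU.2 P hP i).1
  obtain ⟨m', hm', hm0'⟩ := exists_node_dir (hU.2 P hP i').1
  have hk : Adapted (P i) (m + 2) := (adapted_add_two _ _).mpr hm
  have hk' : Adapted (P i') (m' + 2) := (adapted_add_two _ _).mpr hm'
  have hne : coord (P i) (m + 2) ≠ coord (P i') (m' + 2) := by rw [coord_top_of_node hm0, coord_top_of_node hm0']; exact htt.ne
  rcases hDP i i' hii' (m + 2) (m' + 2) hk hk' hne with ⟨r, hr, N, hN, hNP⟩ | ⟨r, hr, N, hN, hNP⟩ | ⟨b, b', hb, hb', N, hN, hag2, h1, h2, h1', h2'⟩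
  · have hr' : r ≠ m := by rw [fin4_add_two_add_two] at hr; exact hr
    obtain ⟨hc, -, -⟩ := served_topdir hU hP hic hm hm0 hN hr' hNP.2.1 hNP.2.2
    have hNi' : N i' = P i' := (hNP.1 i' hii'.symm).symm
    have hNl : N l = P l := (hNP.1 l hli).symm
    exact lvn_contra' hLN hN hii' hc (by rw [hNi']; exact hi'c) (p := l) (p' := i') (by rw [hNl, hNi']; exact hl.ne)
  · have hr' : r ≠ m' := by rw [fin4_add_two_add_two] at hr; exact hr
    obtain ⟨hc, ht, -⟩ := served_topdir hU hP hi'c hm' hm0' hN hr' hNP.2.1 hNP.2.2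
    have hNi : N i = P i := (hNP.1 i hii').symm
    exact lvn_contra' hLN hN hii' (by rw [hNi]; exact hic) hc (p := i) (p' := i') (by rw [hNi, ht]; have := hNP.2.1; omega)
  · have hb0 : b = m + 2 := by
      rcases hb with e | ⟨hap, _⟩
      · exact e
      · exact (not_isApex_of_snd_ne hic hap).elim
    have hb0' : b' = m' + 2 := by
      rcases hb' with e | ⟨hap, _⟩
      · exact e
      · exact (not_isApex_of_snd_ne hi'c hap).elim
    subst hb0; subst hb0'
    obtain ⟨hc, -, -⟩ := served_topdir hU hP hic hm hm0 hN (fin4_ne_add_two m).symm h1 h2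
    obtain ⟨hc', ht', -⟩ := served_topdir hU hP hi'c hm' hm0' hN (fin4_ne_add_two m').symm h1' h2'
    have hNl : N l = P l := hag2 l hli hli'
    exact lvn_contra' hLN hN hii' hc hc' (p := l) (p' := i') (by rw [hNl, ht']; omega)


/-- (K5) packaged: **`SkewPairLawP C`** — in every `P`-cell of `C`, two charged letters of different causal tops `t < t′` see every other letter at top
`≥ t′`. -/
def SkewPairLawP (C : MConfig) : Prop :=
  ∀ P ∈ C.upper, ∀ i i' l : Fin 4, i ≠ i' → l ≠ i → l ≠ i' → (P i).2 ≠ (0, 0) → (P i').2 ≠ (0, 0) →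
    causalTop (P i) < causalTop (P i') → causalTop (P i') ≤ causalTop (P l)

theorem skewPairLawP_of_lvn {h : ℤ} {C : MConfig} (hU : C.InDiamond h) (hD : RuleDMu4Closed C) (hLN : LevelNLocal C) : SkewPairLawP C :=
  fun P hP _ _ _ hii' hli hli' hic hi'c htt =>
    not_lt.mp fun hl => no_skewPairP hU hLN hP (hD.2 P hP) hii' hli hli' hic hi'c htt hl


/-! ## §9 (K6) BELOW THE LINE 8 THE `P`-SIDE LEVEL LAW IS A CONSEQUENCE: (LVP3_h) ⇐ (LVN_h) ∧ (CD_h), h ≤ 8 -/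

theorem chargeCount_congr {N P : MCell} (h : ∀ f, (N f).2 ≠ (0, 0) ↔ (P f).2 ≠ (0, 0)) : chargeCount N = chargeCount P := by
  unfold chargeCount; congr 1; exact Finset.filter_congr fun f _ => h f

theorem chargeCount_eq_four {N : MCell} (h : ∀ f, (N f).2 ≠ (0, 0)) : chargeCount N = 4 := by
  unfold chargeCount; rw [Finset.filter_true_of_mem fun f _ => h f]; simp

/-- with at least three charged letters, every slot other than an uncharged one is charged. -/
theorem charged_of_three {P : MCell} (h3 : 3 ≤ chargeCount P) {g f : Fin 4} (hg : (P g).2 = (0, 0)) (hfg : f ≠ g) : (P f).2 ≠ (0, 0) := by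
  intro hf
  unfold chargeCount at h3
  have hsub : Finset.univ.filter (fun f : Fin 4 => (P f).2 ≠ (0, 0)) ⊆ (Finset.univ.erase g).erase f := by
    intro x hx
    simp only [Finset.mem_filter, Finset.mem_univ, true_and] at hx
    simp only [Finset.mem_erase, Finset.mem_univ, and_true]
    exact ⟨fun e => hx (e ▸ hf), fun e => hx (e ▸ hg)⟩
  have hc := Finset.card_le_card hsub
  rw [Finset.card_erase_of_mem (by simp [hfg]), Finset.card_erase_of_mem (Finset.mem_univ g)] at hc
  simp only [Finset.card_univ, Fintype.card_fin] at hc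
  omega

theorem apex_of_uncharged {x : BPoint} (h : x.2 = (0, 0)) : x = (x.1, 0, 0) := by
  obtain ⟨α, b, c⟩ := x
  simp only [Prod.mk.injEq] at h
  obtain ⟨rfl, rfl⟩ := h; rfl

theorem ray_apex_up_node {a e : ℤ} (he : 0 < e) (u : Fin 4) : nodeLevel (ray ((a, 0, 0) : BPoint) u e) = a := by
  fin_cases u <;> simp [nodeLevel, absCharge, chargeOf, abs_of_pos he]

theorem exists_third (a b : Fin 4) : ∃ c : Fin 4, c ≠ a ∧ c ≠ b := by decide +revert

/-- RESIDUAL SHAPE (A) of the (K6) argument: two charged letters of tops `t < t′`, every letter other than the lower one at top `t′`, and node level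
`≥ 2·(charge count)` at every charged letter (the lower one included).  At `h = 10`: `P_A = [6I+ℓ_u | y | y′ | y″]`, `y`'s ∈ {`10I`, `8I+ℓ`, `6I+2ℓ`}. -/
def K6ResidualA (P : MCell) : Prop :=
  ∃ i i' : Fin 4, i ≠ i' ∧ (P i).2 ≠ (0, 0) ∧ (P i').2 ≠ (0, 0) ∧ causalTop (P i) < causalTop (P i') ∧
    2 * (chargeCount P : ℤ) ≤ nodeLevel (P i) ∧ (∀ l, l ≠ i → causalTop (P l) = causalTop (P i')) ∧
    (∀ l, l ≠ i → (P l).2 ≠ (0, 0) → 2 * (chargeCount P : ℤ) ≤ nodeLevel (P l))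

/-- RESIDUAL SHAPE (B) of (K6): an uncharged apex `aI`, `a ≥ 8`, the other three letters charged, of causal top `> a` and node level `≥ 8`.  At `h = 10`:
`P_B = [8I+ℓ | 8I+ℓ′ | 8I+ℓ″ | 8I]`. -/
def K6ResidualB (P : MCell) : Prop :=
  ∃ g : Fin 4, (P g).2 = (0, 0) ∧ 8 ≤ (P g).1 ∧ ∀ f, f ≠ g → (P f).2 ≠ (0, 0) ∧ (P g).1 < causalTop (P f) ∧ 8 ≤ nodeLevel (P f)

/-- RESIDUAL SHAPE (C) of (K6) (the cover branch): two charged letters of tops `t < t′` and node levels `≥ 2·(charge count)`, the other two letters of top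
`> t′` (node `≥ 2·count` when charged).  Empty at `h ≤ 10`. -/
def K6ResidualC (P : MCell) : Prop :=
  ∃ i i' : Fin 4, i ≠ i' ∧ (P i).2 ≠ (0, 0) ∧ (P i').2 ≠ (0, 0) ∧ causalTop (P i) < causalTop (P i') ∧
    2 * (chargeCount P : ℤ) ≤ nodeLevel (P i) ∧ 2 * (chargeCount P : ℤ) ≤ nodeLevel (P i') ∧
    ∀ l, l ≠ i → l ≠ i' → causalTop (P i') < causalTop (P l) ∧ ((P l).2 ≠ (0, 0) → 2 * (chargeCount P : ℤ) ≤ nodeLevel (P l))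

/-- **(RES_h)** (census UP-fact for `h ≥ 10`, theorem for `h ≤ 8`: `k6ResidualFree_of_le_eight`): no `P`-cell with ≥ 3 charged letters of an H₁-static
◇_h-design has a (K6) residual shape.  At `h = 10` this is a THIN sub-fact of (LVP3₁₀) (residual cells are non-level) carried by the peel j318002 h10
`74004db439790926`: the ◇₁₀ `P`-orbits with ≥ 3 charged letters of shape (A) ∕ (B) ∕ (C) number 36 ∕ 5 ∕ 0 (`P[6I+ℓ | y | y′ | 10I]`, `y, y′ ∈
{8I+ℓ_*, 6I+2ℓ_*}`; `P[8I | 8I+ℓ | 8I+ℓ′ | 8I+ℓ″]`) and ALL 41 are DEAD there, at peel rounds 22–24 (kinds P:DN 16, P:Xp 19, B:DP 3, P:DP 3) — control-g12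
`alpha8/probe10b.py` count.  So (RES₁₀) is a 41-orbit census fact where (LVP3₁₀) is a 205 770-orbit one.  NOT proved for `h ≥ 10`. -/
def K6ResidualFree (h : ℤ) : Prop :=
  ∀ C : MConfig, C.InDiamond h → C.G1Closed → C.StaticH1 → ∀ P ∈ C.upper, 3 ≤ chargeCount P →
    ¬ K6ResidualA P ∧ ¬ K6ResidualB P ∧ ¬ K6ResidualC P

theorem k6Residual_le_eight_A {h : ℤ} {C : MConfig} (hU : C.InDiamond h) (hh : h ≤ 8) {P : MCell} (hP : P ∈ C.upper) (h3 : 3 ≤ chargeCount P) :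
    ¬ K6ResidualA P := fun ⟨i, i', _, hic, _, htt, hle, _⟩ => by
  have h3z : (3 : ℤ) ≤ chargeCount P := by exact_mod_cast h3
  have := one_le_absCharge (hU.2 P hP i).1 hic; have h1 := (hU.2 P hP i').2.2.2
  unfold nodeLevel at hle; unfold causalTop at htt h1; omega

theorem fin4_add_one_ne (g : Fin 4) : g + 1 ≠ g := by decide +revert

theorem k6Residual_le_eight_B {h : ℤ} {C : MConfig} (hU : C.InDiamond h) (hh : h ≤ 8) {P : MCell} (hP : P ∈ C.upper) (_h3 : 3 ≤ chargeCount P) :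
    ¬ K6ResidualB P := fun ⟨g, _, h8, hall⟩ => by
  have hig : g + 1 ≠ g := fin4_add_one_ne g
  have := (hall (g + 1) hig).2.1; have h1 := (hU.2 P hP (g + 1)).2.2.2; unfold causalTop at *; omega

theorem k6Residual_le_eight_C {h : ℤ} {C : MConfig} (hU : C.InDiamond h) (hh : h ≤ 8) {P : MCell} (hP : P ∈ C.upper) (h3 : 3 ≤ chargeCount P) :
    ¬ K6ResidualC P := fun ⟨i, i', _, hic, _, htt, hle, _⟩ => by
  have h3z : (3 : ℤ) ≤ chargeCount P := by exact_mod_cast h3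
  have := one_le_absCharge (hU.2 P hP i).1 hic; have h1 := (hU.2 P hP i').2.2.2
  unfold nodeLevel at hle; unfold causalTop at htt h1; omega

/-- **(K6) (LVP3) BELOW THE LINE 8** (KERNEL): in a RULE-D-closed ◇_h-configuration, `h ≤ 8`, with `LevelNLocal` and the local charge-depth inequalities,
every `P`-cell with at least three charged letters is LEVEL.  RULE D at a pair (top coordinate of a charged letter, a coordinate of different value) only
offers `N`-cells with two charged letters, which (LVN) makes level; levelness then either fails outright (a raise by `2e > 0` against an unchanged letter of
the old top) or forces a level `N`-cell with ≥ 3 charged letters whose raised letter keeps a node level `≤ top − 2 ≤ h − 3 ≤ 5 < 6` — against (CD-`N`)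
`2n ≤ node` (case A: two charged letters of different tops); or, when all charged letters share a top `T` and an apex `aI` (`a ≠ T`) rides along (case B),
the raised apex `[x₁ x₂ x₃ | aI + e·n]` is level only with 4 charged letters and node `a = T − 2e ≤ 6 < 8`.  Hence at `h = 8` the census input (LVP3₈) of
the (T₈) chain `DiamondLevelLaws.seedB1Odd_eight_of_partial_cd` is REDUNDANT given (CD₈) ∧ (LVN₈) (`levelP3Law_of_cd_lvn`; the corollary has to be restated
inside `DiamondLevelLaws`' namespace, whose definitions these copy verbatim).  At `h = 10` the argument leaves exactly the case-A escape `x = 7I ± …` of node 6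
(top 8 under a line-10 triple) — (LVP3₁₀) stays census. -/
theorem levelP3_of_cd_lvn_res {h : ℤ} {C : MConfig} (hU : C.InDiamond h) (hD : RuleDMu4Closed C) (hLN : LevelNLocal C) (hCD : CDIneq C)
    {P : MCell} (hP : P ∈ C.upper) (h3 : 3 ≤ chargeCount P)
    (hRA : ¬ K6ResidualA P) (hRB : ¬ K6ResidualB P) (hRC : ¬ K6ResidualC P) : LevelCell P := by
  by_contra hNL
  have hDP := hD.2 P hP
  have h3z : (3 : ℤ) ≤ chargeCount P := by exact_mod_cast h3
  have htop : ∀ f, causalTop (P f) ≤ h := fun f => (hU.2 P hP f).2.2.2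
  have hnode : ∀ f, (P f).2 ≠ (0, 0) → nodeLevel (P f) ≤ causalTop (P f) - 2 := fun f hf => by
    have := one_le_absCharge (hU.2 P hP f).1 hf; unfold nodeLevel causalTop; omega
  by_cases hA : ∃ i i' : Fin 4, (P i).2 ≠ (0, 0) ∧ (P i').2 ≠ (0, 0) ∧ causalTop (P i) < causalTop (P i')
  · -- case A: two charged letters of different tops `t < t′`
    obtain ⟨i, i', hic, hi'c, htt⟩ := hA
    have hii' : i ≠ i' := by rintro rfl; exact lt_irrefl _ htt
    obtain ⟨m, hm, hm0⟩ := exists_node_dir (hU.2 P hP i).1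
    obtain ⟨m', hm', hm0'⟩ := exists_node_dir (hU.2 P hP i').1
    have hk : Adapted (P i) (m + 2) := (adapted_add_two _ _).mpr hm
    have hk' : Adapted (P i') (m' + 2) := (adapted_add_two _ _).mpr hm'
    have hne : coord (P i) (m + 2) ≠ coord (P i') (m' + 2) := by rw [coord_top_of_node hm0, coord_top_of_node hm0']; exact htt.ne
    rcases hDP i i' hii' (m + 2) (m' + 2) hk hk' hne with ⟨r, hr, N, hN, hNP⟩ | ⟨r, hr, N, hN, hNP⟩ | ⟨b, b', hb, hb', N, hN, hag2, h1, h2, h1', h2'⟩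
    · have hr' : r ≠ m := by rw [fin4_add_two_add_two] at hr; exact hr
      obtain ⟨hc, -, -, hnd⟩ := served_topdir hU hP hic hm hm0 hN hr' hNP.2.1 hNP.2.2
      have hNi' : N i' = P i' := (hNP.1 i' hii'.symm).symm
      have hL : LevelCell N := hLN N hN (two_le_chargeCount hii' hc (by rw [hNi']; exact hi'c))
      have hcc : chargeCount N = chargeCount P := chargeCount_congr fun f => by
        by_cases hf : f = i
        · subst hf; exact ⟨fun _ => hic, fun _ => hc⟩
        · rw [hNP.1 f hf]
      have hcd := hCD.2 N hN hL i hc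
      rw [hcc, hnd] at hcd
      refine hRA ⟨i, i', hii', hic, hi'c, htt, hcd, fun l hl => ?_, fun l hl hlc => ?_⟩
      · have e := hL l i'; rw [← hNP.1 l hl, hNi'] at e; exact e
      · have hcd' := hCD.2 N hN hL l (by rw [← hNP.1 l hl]; exact hlc)
        rw [hcc, ← hNP.1 l hl] at hcd'; exact hcd'
    · have hr' : r ≠ m' := by rw [fin4_add_two_add_two] at hr; exact hr
      obtain ⟨hc', ht', -, -⟩ := served_topdir hU hP hi'c hm' hm0' hN hr' hNP.2.1 hNP.2.2
      have hNi : N i = P i := (hNP.1 i hii').symm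
      have hL : LevelCell N := hLN N hN (two_le_chargeCount hii' (by rw [hNi]; exact hic) hc')
      have e := hL i i'
      rw [hNi, ht'] at e
      have := hNP.2.1; omega
    · have hb0 : b = m + 2 := by
        rcases hb with e | ⟨hap, _⟩
        · exact e
        · exact (not_isApex_of_snd_ne hic hap).elim
      have hb0' : b' = m' + 2 := by
        rcases hb' with e | ⟨hap, _⟩
        · exact e
        · exact (not_isApex_of_snd_ne hi'c hap).elim
      subst hb0; subst hb0'
      obtain ⟨hc, -, -, hnd⟩ := served_topdir hU hP hic hm hm0 hN (fin4_ne_add_two m).symm h1 h2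
      obtain ⟨hc', ht', -, hnd'⟩ := served_topdir hU hP hi'c hm' hm0' hN (fin4_ne_add_two m').symm h1' h2'
      have hL : LevelCell N := hLN N hN (two_le_chargeCount hii' hc hc')
      have hcc : chargeCount N = chargeCount P := chargeCount_congr fun f => by
        by_cases hf : f = i
        · subst hf; exact ⟨fun _ => hic, fun _ => hc⟩
        by_cases hf' : f = i'
        · subst hf'; exact ⟨fun _ => hi'c, fun _ => hc'⟩
        · rw [hag2 f hf hf']
      have hcd := hCD.2 N hN hL i hc
      rw [hcc, hnd] at hcd
      have hcdi' := hCD.2 N hN hL i' hc'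
      rw [hcc, hnd'] at hcdi'
      refine hRC ⟨i, i', hii', hic, hi'c, htt, hcd, hcdi', fun l hl hl' => ⟨?_, fun hlc => ?_⟩⟩
      · have e := hL l i'; rw [hag2 l hl hl', ht'] at e; omega
      · have hcd' := hCD.2 N hN hL l (by rw [hag2 l hl hl']; exact hlc)
        rw [hcc, hag2 l hl hl'] at hcd'; exact hcd'
  · -- case B: all charged letters share a top; an uncharged apex of another top rides along
    push Not at hA
    have heqt : ∀ i i' : Fin 4, (P i).2 ≠ (0, 0) → (P i').2 ≠ (0, 0) → causalTop (P i) = causalTop (P i') :=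
      fun i i' hi hi' => le_antisymm (hA i' i hi' hi) (hA i i' hi hi')
    have hex : ∃ p p' : Fin 4, causalTop (P p) ≠ causalTop (P p') := by
      by_contra hcon; push Not at hcon; exact hNL hcon
    obtain ⟨p, p', hpp'⟩ := hex
    obtain ⟨g, hg0, i₁, hi₁c, hne⟩ : ∃ g, (P g).2 = (0, 0) ∧ ∃ i, (P i).2 ≠ (0, 0) ∧ causalTop (P i) ≠ causalTop (P g) := by
      by_cases hp : (P p).2 = (0, 0)
      · exact ⟨p, hp, p', charged_of_three h3 hp (by rintro rfl; exact hpp' rfl), fun e => hpp' e.symm⟩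
      · by_cases hp' : (P p').2 = (0, 0)
        · exact ⟨p', hp', p, hp, hpp'⟩
        · exact absurd (heqt p p' hp hp') hpp'
    have hi₁g : i₁ ≠ g := by rintro rfl; exact hi₁c hg0
    obtain ⟨i₂, hi₂1, hi₂g⟩ := exists_third i₁ g
    have hi₂c : (P i₂).2 ≠ (0, 0) := charged_of_three h3 hg0 hi₂g
    have hPg : P g = ((P g).1, 0, 0) := apex_of_uncharged hg0
    have hgt : causalTop (P g) = (P g).1 := by rw [hPg]; simp [causalTop, absCharge, chargeOf]
    obtain ⟨m, hm, hm0⟩ := exists_node_dir (hU.2 P hP i₁).1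
    have hk : Adapted (P i₁) (m + 2) := (adapted_add_two _ _).mpr hm
    have hkg : Adapted (P g) 0 := by rw [hPg]; exact adapted_apex _ 0
    have hne' : coord (P i₁) (m + 2) ≠ coord (P g) 0 := by
      rw [coord_top_of_node hm0, hPg, coord_apex, ← hgt]; exact hne
    rcases hDP i₁ g hi₁g (m + 2) 0 hk hkg hne' with ⟨r, hr, N, hN, hNP⟩ | ⟨r, hr, N, hN, hNP⟩ | ⟨b, b', hb, hb', N, hN, hag2, h1, h2, h1', h2'⟩
    · have hr' : r ≠ m := by rw [fin4_add_two_add_two] at hr; exact hr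
      obtain ⟨hc, ht, -, -⟩ := served_topdir hU hP hi₁c hm hm0 hN hr' hNP.2.1 hNP.2.2
      have hNi₂ : N i₂ = P i₂ := (hNP.1 i₂ hi₂1).symm
      have hL : LevelCell N := hLN N hN (two_le_chargeCount hi₂1.symm hc (by rw [hNi₂]; exact hi₂c))
      have e := hL i₁ i₂
      rw [ht, hNi₂, heqt i₁ i₂ hi₁c hi₂c] at e
      have := hNP.2.1; omega
    · -- the apex raised: charged of top `a + 2e`, node `a`
      have he : 0 < (N g).1 - (P g).1 := by have := hNP.2.1; omega
      have hray : N g = ray (((P g).1, 0, 0) : BPoint) r ((N g).1 - (P g).1) := by rw [← hPg]; exact hNP.2.2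
      obtain ⟨hgt', hgc⟩ := ray_apex_up (a := (P g).1) he r
      have hgn := ray_apex_up_node (a := (P g).1) he r
      rw [← hray] at hgt' hgc hgn
      have hNi₁ : N i₁ = P i₁ := (hNP.1 i₁ hi₁g).symm
      have hL : LevelCell N := hLN N hN (two_le_chargeCount hi₁g (by rw [hNi₁]; exact hi₁c) hgc)
      have h4 : chargeCount N = 4 := chargeCount_eq_four fun f => by
        by_cases hf : f = g
        · subst hf; exact hgc
        · rw [← hNP.1 f hf]; exact charged_of_three h3 hg0 hf
      have hcd := hCD.2 N hN hL g hgc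
      rw [h4, hgn] at hcd
      have e := hL g i₁
      rw [hgt', hNi₁] at e
      refine hRB ⟨g, hg0, by omega, fun f hf => ?_⟩
      have hfc : (P f).2 ≠ (0, 0) := charged_of_three h3 hg0 hf
      refine ⟨hfc, by rw [← heqt i₁ f hi₁c hfc]; omega, ?_⟩
      have hcd' := hCD.2 N hN hL f (by rw [← hNP.1 f hf]; exact hfc)
      rw [h4, ← hNP.1 f hf] at hcd'; push_cast at hcd'; omega
    · have hb0 : b = m + 2 := by
        rcases hb with e | ⟨hap, _⟩
        · exact e
        · exact (not_isApex_of_snd_ne hi₁c hap).elim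
      subst hb0
      obtain ⟨hc, ht, -, -⟩ := served_topdir hU hP hi₁c hm hm0 hN (fin4_ne_add_two m).symm h1 h2
      have he' : 0 < (N g).1 - (P g).1 := by omega
      have hray : N g = ray (((P g).1, 0, 0) : BPoint) b' ((N g).1 - (P g).1) := by rw [← hPg]; exact h2'
      obtain ⟨-, hgc⟩ := ray_apex_up (a := (P g).1) he' b'
      rw [← hray] at hgc
      have hNi₂ : N i₂ = P i₂ := hag2 i₂ hi₂1 hi₂g
      have hL : LevelCell N := hLN N hN (two_le_chargeCount hi₁g hc hgc)
      have e := hL i₁ i₂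
      rw [ht, hNi₂, heqt i₁ i₂ hi₁c hi₂c] at e
      omega

/-- **(K6′) (LVP3_h) ⇐ (CD_h) ∧ (LVN_h) ∧ (RES_h), EVERY h** (KERNEL): the (K6) argument is h-uniform up to its three residual shapes. So the (T₁₀) chain
`DiamondLevelLaws.dl3_of_partial_cd_le_ten` may take (RES₁₀) — at `h = 10` exactly the two families `P_A = [6I+ℓ_u | y | y′ | y″]` (`y`'s of top 10 and node
`≥ 6`: `10I`, `8I+ℓ`, `6I+2ℓ`, at least two charged) and `P_B = [8I+ℓ | 8I+ℓ′ | 8I+ℓ″ | 8I]`, the cells the ◇₁₀ peel kills only at round 24 — in place of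
the whole of (LVP3₁₀). -/
theorem levelP3Law_of_cd_lvn_res {h : ℤ} (hCD : ChargeDepthLaw h) (hLV : LevelNLaw h) (hR : K6ResidualFree h) : LevelP3Law h :=
  fun C hU hG hS P hP h3 =>
    levelP3_of_cd_lvn_res hU hS.1 (hLV C hU hG hS) (hCD C hU hG hS) hP h3 (hR C hU hG hS P hP h3).1 (hR C hU hG hS P hP h3).2.1
      (hR C hU hG hS P hP h3).2.2

/-- (RES_h) is automatic for `h ≤ 8` (a charged letter strictly below another's top has node `≤ h − 3 ≤ 5 < 6 ≤ 2·3`; an apex strictly below a charged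
letter's top has `a ≤ h − 1 < 8`). -/
theorem k6ResidualFree_of_le_eight {h : ℤ} (hh : h ≤ 8) : K6ResidualFree h :=
  fun _ hU _ _ _ hP h3 => ⟨k6Residual_le_eight_A hU hh hP h3, k6Residual_le_eight_B hU hh hP h3, k6Residual_le_eight_C hU hh hP h3⟩

/-- **(K6) at `h ≤ 8`** (KERNEL): every `P`-cell with at least three charged letters is LEVEL, given RULE D, `LevelNLocal` and `CDIneq`. -/
theorem levelP3_of_cd_lvn {h : ℤ} {C : MConfig} (hU : C.InDiamond h) (hh : h ≤ 8) (hD : RuleDMu4Closed C) (hLN : LevelNLocal C) (hCD : CDIneq C)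
    {P : MCell} (hP : P ∈ C.upper) (h3 : 3 ≤ chargeCount P) : LevelCell P :=
  levelP3_of_cd_lvn_res hU hD hLN hCD hP h3 (k6Residual_le_eight_A hU hh hP h3) (k6Residual_le_eight_B hU hh hP h3)
    (k6Residual_le_eight_C hU hh hP h3)

/-- **(LVP3_h) ⇐ (CD_h) ∧ (LVN_h) for `h ≤ 8`** (KERNEL; the h-uniform packaging of `levelP3_of_cd_lvn`). -/
theorem levelP3Law_of_cd_lvn {h : ℤ} (hh : h ≤ 8) (hCD : ChargeDepthLaw h) (hLV : LevelNLaw h) : LevelP3Law h :=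
  fun C hU hG hS _ hP h3 => levelP3_of_cd_lvn hU hh hS.1 (hLV C hU hG hS) (hCD C hU hG hS) hP h3


/-! ## §10 (K7) A FLOOR LETTER NEXT TO AN OFF-LINE APEX — the cover hypothesis of (K4) discharged by (K2) + (K5) -/

/-- **(K7) NO FLOOR LETTER NEXT TO AN OFF-LINE APEX WITH A LOW THIRD LETTER** (KERNEL, every `h`; RULE D + (LVN) only): no `N`-cell carries a charged floor
letter `x` at `i`, an apex `aI` at `g` with `a ∉ {0, top x}`, and a third letter at `l` of causal top `< max a (top x)`: a child `P = N(g ↦ y)` of the apex slot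
(K2: `y` charged of top `a`) holds the charged letters `x`, `y` of different tops with the third letter below the larger one — excluded by the skew-pair law (K5).
Kills the covers `[x⁺ | aI | aI | …]` (`top x⁺ > a`) of (K4) and the skew hubs `[x | AI | AI | bI]` with `b > A` (‘-’-class cells: e.g. `N[2ℓ | 2I | 2I | 2I]` r9,
`N[3ℓ | 2I | 2I | 2I]` r8, `N[ℓ | 2I | 2I | 4I]` r9 B:DN of peel j318002 h8). -/
theorem no_floor_offLine_apex {h : ℤ} {C : MConfig} (hU : C.InDiamond h) (hLN : LevelNLocal C) (hD : RuleDMu4Closed C)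
    {N : MCell} (hN : N ∈ C.lower) {i g l : Fin 4} (hig : i ≠ g) (hli : l ≠ i) (hlg : l ≠ g)
    (hi : OnFloor (N i)) (hic : (N i).2 ≠ (0, 0)) {a : ℤ} (hg : N g = (a, 0, 0)) (ha0 : a ≠ 0) (ha : a ≠ causalTop (N i))
    (hl : causalTop (N l) < max a (causalTop (N i))) : False := by
  obtain ⟨P₁, hP₁, -, -, r₁, -, -, ⟨hag, hlt1, hray⟩, -⟩ := twoChildren_of_floor_apex hU hN (hD.1 N hN) hig hi hg ha0
  rw [hg] at hlt1 hray
  have hlt1' : (P₁ g).1 < a := hlt1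
  have hna : ¬ isApex (P₁ g) := not_isApex_between hray (ray_zero (P₁ g) r₁).symm (by omega)
  have hyc : OnCeiling a (P₁ g) := onCeiling_between hray (ray_zero (P₁ g) r₁).symm (by omega)
  have hyt : causalTop (P₁ g) = a := hyc
  have hPi : P₁ i = N i := hag i hig
  have hPl : P₁ l = N l := hag l hlg
  rcases lt_or_gt_of_ne ha with hlt | hgt
  · rw [max_eq_right hlt.le] at hl
    exact no_skewPairP hU hLN hP₁ (hD.2 P₁ hP₁) (i := g) (i' := i) (l := l) hig.symm hlg hli (snd_ne_of_not_isApex hna)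
      (by rw [hPi]; exact hic) (by rw [hyt, hPi]; exact hlt) (by rw [hPl, hPi]; exact hl)
  · rw [max_eq_left hgt.le] at hl
    exact no_skewPairP hU hLN hP₁ (hD.2 P₁ hP₁) (i := i) (i' := g) (l := l) hig hli hlg (by rw [hPi]; exact hic)
      (snd_ne_of_not_isApex hna) (by rw [hPi, hyt]; exact hgt) (by rw [hPl, hyt]; exact hl)

/-- **(K3 ∧ K4 ∧ K7) NO FLOOR `P`-CELL NEXT TO A CHILD AND ITS APEX — the cover hypothesis removed** (KERNEL, every `h`): as `no_floorP_apex`, with `hSub`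
discharged by (K7) (the cover `N = P(i ↦ x⁺, τ ↦ aI)` holds the floor letter `x⁺` of top `> a` next to the apexes `aI` at `τ` and at `g`).  Residual hypotheses:
the two floor-twin families only (census class CD-`N`, n ≥ 2, with a floor letter; `floorTwinFree_of_cd_lvn`). -/
theorem no_floorP_apex' {h : ℤ} {C : MConfig} (hU : C.InDiamond h) (hX : XPlusClosed C) (hD : RuleDMu4Closed C) (hLN : LevelNLocal C)
    {P : MCell} (hP : P ∈ C.upper) {i τ g : Fin 4} (hiτ : i ≠ τ) (hig : i ≠ g) (hτg : τ ≠ g)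
    {a : ℤ} (hi : OnFloor (P i)) (hic : (P i).2 ≠ (0, 0)) (hit : causalTop (P i) = a)
    {u : Fin 4} {d : ℤ} (hd : 0 < d) (hy : ((a, 0, 0) : BPoint) = ray (P τ) u d) (hg : P g = (a, 0, 0))
    (hNTP : ∀ N ∈ C.lower, MAgree N P τ → ¬ isApex (N τ) → OnCeiling a (N τ) → False)
    (hNTZ : ∀ N ∈ C.lower, MAgree2 N P g τ → N τ = (a, 0, 0) → ¬ isApex (N g) → OnCeiling a (N g) → False) : False := by
  refine no_floorP_apex hU hX hD hLN hP hiτ hig hτg hi hic hit hd hy hg hNTP hNTZ ?_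
  intro N hN hag2 hNτ hfl hlt
  have hxfl : (P i).1 = absCharge (P i) := hi
  have hNfl : (N i).1 = absCharge (N i) := hfl
  have hc1 := one_le_absCharge (hU.2 P hP i).1 hic
  have hNc : (N i).2 ≠ (0, 0) := fun h0 => by
    have : absCharge (N i) = 0 := by simp [absCharge, chargeOf, h0]
    omega
  have hNg : N g = (a, 0, 0) := (hag2 g hig.symm hτg.symm).trans hg
  have hti : causalTop (N i) = 2 * (N i).1 := by unfold causalTop; omega
  have hta : a = 2 * (P i).1 := by unfold causalTop at hit; omega
  have hgt' : causalTop (N g) = a := by rw [hNg]; simp [causalTop, absCharge, chargeOf]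
  refine no_floor_offLine_apex hU hLN hD hN hiτ hig.symm hτg.symm hfl hNc hNτ (by omega) (by omega) ?_
  rw [hgt', max_eq_right (by omega : a ≤ causalTop (N i))]
  omega

/-- the level CD-`P` (n = 3, floor) class without residual cover hypothesis (cf. `no_floorP_apex_charged`). -/
theorem no_floorP_apex_charged' {h : ℤ} {C : MConfig} (hU : C.InDiamond h) (hX : XPlusClosed C) (hD : RuleDMu4Closed C) (hLN : LevelNLocal C)
    {P : MCell} (hP : P ∈ C.upper) {i τ g : Fin 4} (hiτ : i ≠ τ) (hig : i ≠ g) (hτg : τ ≠ g)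
    {a : ℤ} (hi : OnFloor (P i)) (hic : (P i).2 ≠ (0, 0)) (hit : causalTop (P i) = a)
    {u : Fin 4} {d : ℤ} (hd : 0 < d) (hy : ((a, 0, 0) : BPoint) = ray (P τ) u d) (hg : P g = (a, 0, 0))
    (hFT : ∀ X ∈ C.lower, ∀ i g f : Fin 4, i ≠ g → i ≠ f → f ≠ g →
      OnFloor (X i) → (X i).2 ≠ (0, 0) → X f = (causalTop (X i), 0, 0) → ¬ isApex (X g) → causalTop (X g) = causalTop (X i) → False) : False := by
  refine no_floorP_apex' hU hX hD hLN hP hiτ hig hτg hi hic hit hd hy hg ?_ ?_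
  · intro N hN hag hna hc
    have hNi : N i = P i := hag i hiτ
    have hNg : N g = (a, 0, 0) := (hag g hτg.symm).trans hg
    exact hFT N hN i τ g hiτ hig hτg.symm (by rw [hNi]; exact hi) (by rw [hNi]; exact hic) (by rw [hNg, hNi, hit]) hna
      (by rw [hNi, hit]; exact hc)
  · intro N hN hag2 hNτ hna hc
    have hNi : N i = P i := hag2 i hig hiτ
    exact hFT N hN i g τ hig hiτ hτg (by rw [hNi]; exact hi) (by rw [hNi]; exact hic) (by rw [hNτ, hNi, hit]) hna
      (by rw [hNi, hit]; exact hc)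

/-- **(FP2_h) FLOOR-`P`-APEX-FREE**: no `P`-cell of an H₁-static ◇_h-design holds a charged floor letter `x` (top `a`), a child `y` of `aI` (a point strictly
below `aI` on a null ray) and the apex `aI` (census classes CD-`P`, n = 2 with a floor letter, and n = 3 with a floor letter and an apex). -/
def FloorPApexFree (h : ℤ) : Prop :=
  ∀ C : MConfig, C.InDiamond h → C.G1Closed → C.StaticH1 → ∀ P ∈ C.upper, ∀ i τ g : Fin 4, i ≠ τ → i ≠ g → τ ≠ g →
    OnFloor (P i) → (P i).2 ≠ (0, 0) → P g = (causalTop (P i), 0, 0) →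
    ∀ u : Fin 4, ∀ d : ℤ, 0 < d → ((causalTop (P i), 0, 0) : BPoint) = ray (P τ) u d → False

/-- **(LVN_h) ∧ (FT_h) ⇒ (FP2_h)** (KERNEL, every `h`): the edge `(LVN) ∧ (CD-N floor twins) ⇒ (CD-P, n = 2 ∕ 3, floor, with an apex)` of the UP-fact DAG. -/
theorem floorPApexFree_of_laws {h : ℤ} (hLV : LevelNLaw h) (hTW : FloorTwinFree h) : FloorPApexFree h := by
  intro C hU hG hS P hP i τ g hiτ hig hτg hi hic hg u d hd hy
  exact no_floorP_apex_charged' hU hS.2.1 hS.1 (hLV C hU hG hS) hP hiτ hig hτg hi hic rfl hd hy hg (hTW C hU hG hS)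

/-- hence (CD_h) ∧ (LVN_h) ⇒ (FP2_h) (KERNEL). -/
theorem floorPApexFree_of_cd_lvn {h : ℤ} (hCD : ChargeDepthLaw h) (hLV : LevelNLaw h) : FloorPApexFree h :=
  floorPApexFree_of_laws hLV (floorTwinFree_of_cd_lvn hCD hLV)


/-! ## §11 (K8) THE FLOOR-ANCHORED RULE-D STEP: (LVP3) ⇒ (LVN) on the floor-anchored cells, every `h` -/

/-- **(K2″) RULE D at an `N`-cell with a FLOOR letter settles every NON-ZERO adapted coordinate of any other letter below** (KERNEL, every `h`; the general
form of (K2) = the tree's floor engine `DiamondLevelLaws.servedBelow_of_floorLetter`, restated because Cruxes modules do not import each other): the floor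
letter (node coordinate `0`) can be neither served nor covered below off its top ray. -/
theorem settledBelow_of_floorLetter {h : ℤ} {C : MConfig} (hU : C.InDiamond h) {Z : MCell} (hZ : Z ∈ C.lower) (hD : RuleDMu4N C Z)
    {i g : Fin 4} (hig : i ≠ g) (hi : OnFloor (Z i)) {k : Fin 4} (hk : Adapted (Z g) k) (hne : coord (Z g) k ≠ 0) :
    SettledBelow C Z g k := by
  obtain ⟨m, hm, hm0⟩ := exists_node_dir (hU.1 Z hZ i).1
  have hm0' : coord (Z i) m = 0 := by rw [hm0, hi, sub_self]
  have hne' : coord (Z i) m ≠ coord (Z g) k := by rw [hm0']; exact fun e => hne e.symm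
  have below : ∀ P ∈ C.upper, ∀ r : Fin 4, r ≠ m + 2 → (P i).1 < (Z i).1 → Z i = ray (P i) r ((Z i).1 - (P i).1) → False :=
    fun P hP r hr hlt hray =>
      not_inDiamond_below_offtop hi (hU.1 Z hZ i).1 hm hm0' hr (by omega) hray (hU.2 P hP i).1 (hU.2 P hP i).2.1
  rcases hD i g hig m k hm hk hne' with ⟨r, hr, P, hP, hZP⟩ | hS | ⟨r, b, hr, _, P, hP, _, hi1, hi2, _, _⟩
  · exact (below P hP r hr hZP.2.1 hZP.2.2).elim
  · exact hS
  · have hr' : r ≠ m + 2 := by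
      rcases hr with e | ⟨_, hne2⟩
      · rw [e]; exact fin4_ne_add_two m
      · exact hne2
    exact (below P hP r hr' hi1 hi2).elim

/-- a CHILD ON THE LINE: if the charged ◇-letter `x` (node direction `m`) is the ◇-letter `y` raised by `e > 0` steps in a direction `r ≠ m + 2`, then `y` is
charged, has the causal top of `x`, and node level `node x − 2e`. -/
theorem lineChild_of_ray {x y : BPoint} {m r : Fin 4} {e : ℤ} (hxax : x.2 = (0, 0) ∨ AxisPt x) (hna : x.2 ≠ (0, 0))
    (hm : Adapted x m) (hm0 : coord x m = x.1 - absCharge x) (hr : r ≠ m + 2) (he : 0 < e) (hxy : x = ray y r e)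
    (hyax : y.2 = (0, 0) ∨ AxisPt y) (hy : absCharge y ≤ y.1) :
    y.2 ≠ (0, 0) ∧ causalTop y = causalTop x ∧ nodeLevel y + 2 * e = nodeLevel x := by
  obtain ⟨α, a, b⟩ := y
  subst hxy
  simp only [causalTop, nodeLevel, absCharge, chargeOf, coord, AxisPt, Adapted, Prod.mk.injEq, ne_eq] at *
  fin_cases m <;> fin_cases r <;> simp at hxax hna hm hm0 hr hyax hy ⊢ <;>
    (simp only [abs_eq_max_neg, max_def] at *; split_ifs at * <;> omega)

/-- **(K8) THE FLOOR-ANCHORED RULE-D STEP** (KERNEL, every `h`): an `N`-cell obeying RULE D with a floor letter (charged or `O`) at `i` and a CHARGED letter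
`x` of POSITIVE node level at `g` has a `P`-child `Z(g ↦ y)` with `y` strictly deeper ON THE LINE of `x` (charged, same causal top, smaller node level).
This is the dominant unit-propagation mechanism behind (LVN) in the ◇₈ census: of the 46 586 (LVN) orbits 39 400 carry a floor letter, and 24 317 die
base-forced (kind B:DN) by a RULE-D clause of exactly this shape, all of whose children are non-level `P`-cells — (LVP3)-class (87 %) or 2-charged (13 %)
(control-g12 `alpha8/out_lvnkill.txt`, sample 3 000; peel j318002 h8 `a459e02921a60310`). -/
theorem floorAnchor_lineChild {h : ℤ} {C : MConfig} (hU : C.InDiamond h) {Z : MCell} (hZ : Z ∈ C.lower) (hD : RuleDMu4N C Z)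
    {i g : Fin 4} (hig : i ≠ g) (hi : OnFloor (Z i)) (hgc : (Z g).2 ≠ (0, 0)) (hgn : 0 < nodeLevel (Z g)) :
    ∃ P ∈ C.upper, MAgree P Z g ∧ (P g).2 ≠ (0, 0) ∧ causalTop (P g) = causalTop (Z g) ∧ nodeLevel (P g) < nodeLevel (Z g) := by
  obtain ⟨m, hm, hm0⟩ := exists_node_dir (hU.1 Z hZ g).1
  have hne : coord (Z g) m ≠ 0 := by rw [hm0]; unfold nodeLevel at hgn; omega
  obtain ⟨r, hr, P, hP, hag, hlt, hray⟩ := settledBelow_of_floorLetter hU hZ hD hig hi hm hne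
  obtain ⟨hc, ht, hn⟩ := lineChild_of_ray (hU.1 Z hZ g).1 hgc hm hm0 hr (by omega) hray (hU.2 P hP g).1 (hU.2 P hP g).2.1
  exact ⟨P, hP, hag, hc, ht, by omega⟩

/-- the charge count of a cell agreeing with `Z` off `g`, charged at `g` where `Z` is not, is one more. -/
theorem chargeCount_agree_succ {P Z : MCell} {g : Fin 4} (hag : MAgree P Z g) (hZg : (Z g).2 = (0, 0)) (hPg : (P g).2 ≠ (0, 0)) :
    chargeCount P = chargeCount Z + 1 := by
  unfold chargeCount
  have hset : Finset.univ.filter (fun f : Fin 4 => (P f).2 ≠ (0, 0)) = insert g (Finset.univ.filter (fun f : Fin 4 => (Z f).2 ≠ (0, 0))) := by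
    ext f
    simp only [Finset.mem_filter, Finset.mem_univ, true_and, Finset.mem_insert]
    by_cases hf : f = g
    · subst hf; exact ⟨fun _ => Or.inl rfl, fun _ => hPg⟩
    · rw [hag f hf]; exact ⟨fun h => Or.inr h, fun h => h.resolve_left hf⟩
  rw [hset, Finset.card_insert_of_notMem (by simp [hZg])]

/-- the charge count of a cell agreeing with `Z` off `g`, both charged at `g`, is the same. -/
theorem chargeCount_agree_eq {P Z : MCell} {g : Fin 4} (hag : MAgree P Z g) (hZg : (Z g).2 ≠ (0, 0)) (hPg : (P g).2 ≠ (0, 0)) :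
    chargeCount P = chargeCount Z :=
  chargeCount_congr fun f => by
    by_cases hf : f = g
    · subst hf; exact ⟨fun _ => hZg, fun _ => hPg⟩
    · rw [hag f hf]

/-- levelness transfers along a one-slot change keeping the causal top. -/
theorem levelCell_of_agree {P Z : MCell} {g : Fin 4} (hag : MAgree P Z g) (ht : causalTop (P g) = causalTop (Z g)) (hL : LevelCell P) :
    LevelCell Z := by
  have key : ∀ f, causalTop (Z f) = causalTop (P f) := fun f => by
    by_cases hf : f = g
    · subst hf; exact ht.symm
    · rw [hag f hf]
  intro f f'; rw [key f, key f']; exact hL f f'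

/-- **(K8a) (LVP3) ⇒ (LVN) AT A FLOOR-ANCHORED CELL WITH A CHARGED LETTER OFF THE FLOOR** (KERNEL, every `h`): with RULE D below and the (LVP3) instances
(`P`-cells with ≥ 3 charged letters are level), every `N`-cell with ≥ 3 charged letters, a floor letter, and a charged letter of positive node level is LEVEL —
its (K8) child is a `P`-cell with the same charge count and the same causal tops. -/
theorem lvn_of_lvp3_floorAnchor {h : ℤ} {C : MConfig} (hU : C.InDiamond h) (hDN : ∀ Z ∈ C.lower, RuleDMu4N C Z)
    (hLV3 : ∀ P ∈ C.upper, 3 ≤ chargeCount P → LevelCell P) {Z : MCell} (hZ : Z ∈ C.lower)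
    {i g : Fin 4} (hig : i ≠ g) (hi : OnFloor (Z i)) (hgc : (Z g).2 ≠ (0, 0)) (hgn : 0 < nodeLevel (Z g)) (h3 : 3 ≤ chargeCount Z) :
    LevelCell Z := by
  obtain ⟨P, hP, hag, hc, ht, -⟩ := floorAnchor_lineChild hU hZ (hDN Z hZ) hig hi hgc hgn
  exact levelCell_of_agree hag ht (hLV3 P hP (by rw [chargeCount_agree_eq hag hgc hc]; exact h3))

/-- **(K8b) (LVP3) ⇒ (LVN) AT A FLOOR-ANCHORED CELL WITH AN APEX `aI ≠ O`** (KERNEL, every `h`): with RULE D below and the (LVP3) instances, every `N`-cell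
with ≥ 2 charged letters, a floor letter and an apex letter `aI`, `a ≠ 0`, is LEVEL — a (K2) child `Z(g ↦ y)` (`y` charged of top `a`) is a `P`-cell with one
more charged letter and the same causal tops. -/
theorem lvn_of_lvp3_floorApex {h : ℤ} {C : MConfig} (hU : C.InDiamond h) (hDN : ∀ Z ∈ C.lower, RuleDMu4N C Z)
    (hLV3 : ∀ P ∈ C.upper, 3 ≤ chargeCount P → LevelCell P) {Z : MCell} (hZ : Z ∈ C.lower)
    {i g : Fin 4} (hig : i ≠ g) (hi : OnFloor (Z i)) {a : ℤ} (hg : Z g = (a, 0, 0)) (ha : a ≠ 0) (h2 : 2 ≤ chargeCount Z) :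
    LevelCell Z := by
  obtain ⟨P₁, hP₁, -, -, r₁, -, -, ⟨hag, hlt1, hray⟩, -⟩ := twoChildren_of_floor_apex hU hZ (hDN Z hZ) hig hi hg ha
  rw [hg] at hlt1 hray
  have hlt1' : (P₁ g).1 < a := hlt1
  have hna : ¬ isApex (P₁ g) := not_isApex_between hray (ray_zero (P₁ g) r₁).symm (by omega)
  have hyc : OnCeiling a (P₁ g) := onCeiling_between hray (ray_zero (P₁ g) r₁).symm (by omega)
  have hyt : causalTop (P₁ g) = causalTop (Z g) := by
    rw [hg]; simp only [causalTop, absCharge, chargeOf, sub_zero, abs_zero, add_zero]; exact hyc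
  have hZg : (Z g).2 = (0, 0) := by rw [hg]
  have hcc := chargeCount_agree_succ hag hZg (snd_ne_of_not_isApex hna)
  exact levelCell_of_agree hag hyt (hLV3 P₁ hP₁ (by rw [hcc]; omega))

/-- **(K8) PACKAGED: (LVP3_h) ⇒ (LVN_h) ON THE FLOOR-ANCHORED CELLS** (KERNEL, every `h`): under the (LVP3_h) instances of an H₁-static ◇_h-design, a
NON-LEVEL `N`-cell with ≥ 2 charged letters and a floor letter has all its charged letters ON THE FLOOR when it has ≥ 3 of them, and all its apex letters
equal to `O` — the complement (census: the all-floor cells and the 2-charged cells `[x | x′ | O | O]`) is the floor-anchored residue of (LVN). -/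
theorem lvn_floorAnchored_residue {h : ℤ} (hLP : LevelP3Law h) {C : MConfig} (hU : C.InDiamond h) (hG : C.G1Closed) (hS : C.StaticH1)
    {Z : MCell} (hZ : Z ∈ C.lower) (h2 : 2 ≤ chargeCount Z) (hnl : ¬ LevelCell Z) {i : Fin 4} (hi : OnFloor (Z i)) :
    (3 ≤ chargeCount Z → ∀ g, g ≠ i → (Z g).2 ≠ (0, 0) → nodeLevel (Z g) = 0) ∧ (∀ g, g ≠ i → (Z g).2 = (0, 0) → Z g = (0, 0, 0)) := by
  have hLV3 : ∀ P ∈ C.upper, 3 ≤ chargeCount P → LevelCell P := fun P hP h3 => hLP C hU hG hS P hP h3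
  refine ⟨fun h3 g hgi hgc => ?_, fun g hgi hg0 => ?_⟩
  · by_contra hn
    have hnn : 0 ≤ nodeLevel (Z g) := by have := (hU.1 Z hZ g).2.1; unfold nodeLevel; omega
    exact hnl (lvn_of_lvp3_floorAnchor hU hS.1.1 hLV3 hZ (Ne.symm hgi) hi hgc (by omega) h3)
  · have hx := apex_of_uncharged hg0
    by_contra hne
    have ha : (Z g).1 ≠ 0 := fun h0 => hne (by rw [hx, h0])
    exact hnl (lvn_of_lvp3_floorApex hU hS.1.1 hLV3 hZ (Ne.symm hgi) hi hx ha h2)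


/-- a CHILD OF A FLOOR LETTER: if the charged floor letter `x` (node direction `m`) is the ◇-letter `y` raised by `e > 0` steps in a direction `r ≠ m`,
then `y` is a floor letter of causal top `top x − 2e` (the letter `(c − e)·ℓ_u` of the same phase, or `O`). -/
theorem floorChild_of_ray {x y : BPoint} {m r : Fin 4} {e : ℤ} (hx : OnFloor x) (hxax : x.2 = (0, 0) ∨ AxisPt x) (hna : x.2 ≠ (0, 0))
    (hm : Adapted x m) (hm0 : coord x m = 0) (hr : r ≠ m) (he : 0 < e) (hxy : x = ray y r e)
    (hyax : y.2 = (0, 0) ∨ AxisPt y) (hy : absCharge y ≤ y.1) : OnFloor y ∧ causalTop y + 2 * e = causalTop x := by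
  obtain ⟨α, a, b⟩ := y
  subst hxy
  simp only [OnFloor, causalTop, absCharge, chargeOf, coord, AxisPt, Adapted, Prod.mk.injEq, ne_eq] at *
  fin_cases m <;> fin_cases r <;> simp at hx hxax hna hm hm0 hr hyax hy ⊢ <;>
    (simp only [abs_eq_max_neg, max_def] at *; split_ifs at * <;> omega)

/-- three distinct charged slots give charge count `≥ 3`. -/
theorem three_le_chargeCount {Z : MCell} {a b c : Fin 4} (hab : a ≠ b) (hac : a ≠ c) (hbc : b ≠ c)
    (ha : (Z a).2 ≠ (0, 0)) (hb : (Z b).2 ≠ (0, 0)) (hc : (Z c).2 ≠ (0, 0)) : 3 ≤ chargeCount Z := by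
  unfold chargeCount
  have hsub : ({a, b, c} : Finset (Fin 4)) ⊆ Finset.univ.filter (fun f : Fin 4 => (Z f).2 ≠ (0, 0)) := by
    intro x hx
    simp only [Finset.mem_insert, Finset.mem_singleton] at hx
    simp only [Finset.mem_filter, Finset.mem_univ, true_and]
    rcases hx with rfl | rfl | rfl
    · exact ha
    · exact hb
    · exact hc
  have h := Finset.card_le_card hsub
  rw [Finset.card_insert_of_notMem (by simp [hab, hac]), Finset.card_insert_of_notMem (by simp [hbc]), Finset.card_singleton] at h
  omega

/-- **(K8c) (LVP3) ∧ (CD-P) ⇒ (LVN) AT THE ALL-FLOOR FULLY CHARGED CELLS** (KERNEL, every `h`): an `N`-cell whose four letters are charged floor letters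
is LEVEL, given RULE D below, the (LVP3) instances and the `P`-side charge-depth inequalities: RULE D at the pair (node coordinate `0` of `x₀`, top
coordinate of `x₁`) lowers `x₁` along its phase to a floor letter `y`; the child `Z(1 ↦ y)` is a non-level `P`-cell with ≥ 3 charged letters, or a level
all-floor fully charged `P`-cell (node level `0 < 2·4 − 2`).  (◇₈ census: the 940 all-floor 4-charged (LVN) orbits.) -/
theorem lvn_of_lvp3_allFloor {h : ℤ} {C : MConfig} (hU : C.InDiamond h) (hDN : ∀ Z ∈ C.lower, RuleDMu4N C Z)
    (hLV3 : ∀ P ∈ C.upper, 3 ≤ chargeCount P → LevelCell P)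
    (hCDP : ∀ P ∈ C.upper, LevelCell P → ∀ f, (P f).2 ≠ (0, 0) → 2 * (chargeCount P : ℤ) - 2 ≤ nodeLevel (P f))
    {Z : MCell} (hZ : Z ∈ C.lower) (hfl : ∀ f, OnFloor (Z f)) (hch : ∀ f, (Z f).2 ≠ (0, 0)) : LevelCell Z := by
  by_contra hnl
  obtain ⟨m, hm, hm0⟩ := exists_node_dir (hU.1 Z hZ 1).1
  have hfl1 : (Z 1).1 = absCharge (Z 1) := hfl 1
  have hm0' : coord (Z 1) m = 0 := by rw [hm0]; omega
  have hc1 := one_le_absCharge (hU.1 Z hZ 1).1 (hch 1)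
  have hc0 := one_le_absCharge (hU.1 Z hZ 0).1 (hch 0)
  have hfl0 : (Z 0).1 = absCharge (Z 0) := hfl 0
  have htop : coord (Z 1) (m + 2) = causalTop (Z 1) := coord_top_of_node hm0
  have hne : coord (Z 1) (m + 2) ≠ 0 := by rw [htop]; unfold causalTop; omega
  obtain ⟨r, hr, P, hP, hag, hlt, hray⟩ :=
    settledBelow_of_floorLetter hU hZ (hDN Z hZ) (i := 0) (g := 1) (by decide) (hfl 0) ((adapted_add_two (Z 1) m).2 hm) hne
  rw [fin4_add_two_add_two] at hr
  obtain ⟨hyfl, hyt⟩ := floorChild_of_ray (hfl 1) (hU.1 Z hZ 1).1 (hch 1) hm hm0' hr (by omega) hray (hU.2 P hP 1).1 (hU.2 P hP 1).2.1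
  have hP0 : P 0 = Z 0 := hag 0 (by decide)
  have hP2 : P 2 = Z 2 := hag 2 (by decide)
  have hP3 : P 3 = Z 3 := hag 3 (by decide)
  have h3 : 3 ≤ chargeCount P :=
    three_le_chargeCount (a := 0) (b := 2) (c := 3) (by decide) (by decide) (by decide)
      (by rw [hP0]; exact hch 0) (by rw [hP2]; exact hch 2) (by rw [hP3]; exact hch 3)
  have hL : LevelCell P := hLV3 P hP h3
  have hyfl' : (P 1).1 = absCharge (P 1) := hyfl
  by_cases hPc : (P 1).2 = (0, 0)
  · -- `y = O`: causal top `0` against the top `≥ 2` of `x₀`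
    have ha0 : absCharge (P 1) = 0 := by simp [absCharge, chargeOf, hPc]
    have h01 := hL 0 1
    rw [hP0] at h01
    unfold causalTop at h01; omega
  · -- `y` charged: the child is LEVEL, all floor, fully charged — against (CD-P)
    have hcc : chargeCount P = 4 := chargeCount_eq_four fun f => by
      by_cases hf : f = 1
      · subst hf; exact hPc
      · rw [hag f hf]; exact hch f
    have hcd := hCDP P hP hL 1 hPc
    rw [hcc] at hcd
    unfold nodeLevel at hcd; omega


/-- **(K8) PACKAGED WITH (CD): THE FLOOR-ANCHORED RESIDUE OF (LVN)** (KERNEL, every `h`): under (LVP3_h) and (CD_h), a NON-LEVEL `N`-cell of an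
H₁-static ◇_h-design with ≥ 2 charged letters and a floor letter (anchor) has every apex letter off the anchor equal to `O`, and — if it has ≥ 3 charged
letters — all its charged letters on the floor and NOT all four slots charged; i.e. it is `[x | x′ | O | O]` or `[c·ℓ | c′·ℓ′ | c″·ℓ″ | O]` up to slots
(◇₈ census j318002 h8 `a459e02921a60310`: 210 + 204 of the 46 586 (LVN) orbits; 38 986 floor-anchored (LVN) orbits are (K8a)–(K8c) instances and 7 186
(LVN) orbits carry no floor letter — control-g12 count, `alpha8`).  (LVN_h) itself is NOT proved. -/
theorem lvn_floorAnchored_residue_of_laws {h : ℤ} (hLP : LevelP3Law h) (hCDL : ChargeDepthLaw h) {C : MConfig} (hU : C.InDiamond h)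
    (hG : C.G1Closed) (hS : C.StaticH1) {Z : MCell} (hZ : Z ∈ C.lower) (h2 : 2 ≤ chargeCount Z) (hnl : ¬ LevelCell Z)
    {i : Fin 4} (hi : OnFloor (Z i)) :
    (∀ g, g ≠ i → (Z g).2 = (0, 0) → Z g = (0, 0, 0)) ∧
      (3 ≤ chargeCount Z → (∀ g, (Z g).2 ≠ (0, 0) → nodeLevel (Z g) = 0) ∧ ∃ g, (Z g).2 = (0, 0)) := by
  obtain ⟨hA, hB⟩ := lvn_floorAnchored_residue hLP hU hG hS hZ h2 hnl hi
  have hi' : (Z i).1 = absCharge (Z i) := hi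
  refine ⟨hB, fun h3 => ⟨fun g hgc => ?_, ?_⟩⟩
  · by_cases hgi : g = i
    · subst hgi; unfold nodeLevel; omega
    · exact hA h3 g hgi hgc
  · by_contra hall
    push Not at hall
    have hfl : ∀ f, OnFloor (Z f) := fun f => by
      by_cases hfi : f = i
      · subst hfi; exact hi
      · have hn := hA h3 f hfi (hall f)
        unfold nodeLevel at hn
        show (Z f).1 = absCharge (Z f)
        omega
    exact hnl (lvn_of_lvp3_allFloor hU hS.1.1 (fun P hP h3 => hLP C hU hG hS P hP h3) (hCDL C hU hG hS).1 hZ hfl hall)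


end Summit.HodgeConjecture.HodgeConjecture.Cruxes.BlochSeedDiscOne.DiamondUpFacts
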